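import Literature.MathematicalPhysics.QuantumFieldTheory.Balaban1983to89.B2Ineq329RegularField
import Literature.MathematicalPhysics.QuantumFieldTheory.Balaban1983to89.B1Ineq233LowerZeroFieldTorus
import Literature.MathematicalPhysics.QuantumFieldTheory.Balaban1983to89.B1Ineq225BackgroundTorus

/-!
# `Balaban1983to89.B1Ineq233LowerBackgroundTorus` — T. Bałaban, *(Higgs)₂,₃ quantum fields in a finite volume. I. A lower bound*,
# Commun. Math. Phys. **85** (1982) 603–626 [Balaban1982Higgs1], PROPOSITION 2.3 (2.33) p. 611, LOWER HALF
# `γ₀I ≦ aL⁻²P(A) + Δ^{(k)}(Ω, A)` **AT A REGULAR BACKGROUND `A ≠ 0`, `Ω = T_ε`, `1 ≦ k < K`**, on the concrete (Higgs)₂,₃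
# carrier, by the printed route of [Balaban1983RegularityDecay] §5 (5.2)–(5.3) p. 593 — Proposition II.3.1′ at the regular
# field (p23's `B2Ineq329RegularField.ineq329_regular_deltaKA`) + the block term of (5.2) handled by a COVARIANT BLOCK POINCARÉ
# INEQUALITY (the blocks «gauged away» along the contours (2.7); the printed «A = A₀ + A′, expand in A′» replaced by the exact
# one-step prism holonomy of p23's staircase toolkit) — and INSTANTIATED AT THE BACKGROUND `A^{(k),ε}` OF (3.29) through p35's
# regularity `B1Ineq225BackgroundTorus.norm_sderiv_bgVec_le`.  The first `A ≠ 0` instance of the lower half of (2.33) on this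
# carrier (the `hlow` input of r14 g7's `B1Ineq234Concrete.ineq234_concrete_of_deltaKA` at `A ≠ 0`).

statement-level skeleton of published theorems with citation tags; proofs where landed; nothing here is a claim about the Yang–Mills mass gap

PDF held: `paper:balaban1982-cmp85-higgs23-i` (journal page = PDF page + 602): p. 604 [PDF 2] ((1.4), (1.5), (1.7)), pp. 606–607
[PDF 4–5] ((1.17)–(1.20)), p. 608 [PDF 6] ((2.1)–(2.3), (2.7)), p. 610 [PDF 8] ((2.23)), p. 611 [PDF 9] (Prop. 2.3 (2.33); text
layer `p0009.txt` l. 31–35 read by this seat), p. 617 [PDF 15] ((3.29)); `paper:balaban1982-cmp86-higgs23-ii` (journal = PDF +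
554): p. 570 [PDF 16] ((2.55)), pp. 589–590 [PDF 35–36] (Prop. 3.1, (3.29)); `paper:balaban1983-cmp89-regularity-decay`
(journal = PDF + 570): p. 574 [PDF 4] (Prop. 3.1′ (1.21)–(1.22)), p. 580 [PDF 10] ((2.27)), p. 590 [PDF 20] («A = A₀ + A′»),
p. 593 [PDF 23] (§5 (5.2)–(5.3); render `1983-cmp89-regularity-decay-p023-x2.png` read by this seat).

CITATION HEADER (lean-in-tree rule).  Cell `lit-balaban` (HOME `run/shared/lean/pub/lit-balaban/`), reader/typer seat **r14**
gen 13 (unit `lit-balaban-r14`, B1 fold owner; TAKING line HOME/STATUS.md 2026-08-22T03:19:04Z, free-target protocol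
G.5-34(d)), SKELETON row **B1.Prop2.3** (member (2.33) lower half; decls of record `B1.Prop23Literal`/`Prop23Intended`; head
`proved …` led by p17's `A ≠ 0` model instances on the b04 carrier; on THIS carrier the lower half of (2.33) was available at
`A = 0` only — r14 g7 `B1Ineq233LowerZeroFieldTorus.ineq233_lower_zeroField_all`, r14 g8/g9 region files), twin row
**B4.Prop2.3** / B4 Sect. 5 (owner r01), input rows **B2.Prop3.1** ((3.29) at a regular field, p23 g11 p312469
`B2Ineq329RegularField`) and **B1.Prop2.1** ((2.23)/(3.29) regularity of `A^{(k),ε}`, p35 g8 `B1Ineq225BackgroundTorus`, p14 g10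
`B1Ineq225DerivZeroFieldTorus`); referee ref-1.  USED BY NAME, never restated: p23's staircase/holonomy toolkit
`B2Ineq329PrismHolonomy.{shift_shiftN_comm, val_toFinest, corner_eq_cornerN, shiftN_cornerN_succ, abs_sub_le_of_stair}`,
`B2Ineq329ZeroAveraging.{shiftN_*, shift_shiftN, sitesPerDir_zero_eq}`, `B2Restr216Lattice.{cornerN, val_blockOf, norm_U_apply,
sitesPerDir_eq_mul}`, `B2Ineq329CovariantAveraging.{norm_U_apply_sub_le, U_apply_U, U_mesh_barA, sum_inside_tgt_le}`,
`B2Ineq329RegularField.{ineq329_regular_deltaKA, gamma0_regular_spec}` (p312469), p33's `B2Eq255Concrete.barA` ((II.2.55)), r14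
g7's `B1Ineq233LowerZeroField.{block_poincare_vec, sum_ite_inside_block_le, mesh_succ}` (p257612) and
`B1Ineq233LowerZeroFieldTorus.{pieceF_eq_univ, inside_of_univ, extL_comp_val, massK_comp_val, bondInner_self_nonneg}` (p259640),
r14/p35's `B1Eq27StepAdjoint.{avgQLin, avgQLin_apply, mesh_succ_pow_mul}`, `B1Eq230FluctCov.{blockProjA, precOpA, deltaKA}`,
the typer's `B1Eq230FluctCovPos.siteInner_blockProjA_eq`, `HiggsAveraging.{toFinest, segSum, corner, contourSum, avgQ_apply}`,
p35 g8's `B1Ineq225BackgroundTorus.{apply_shift_sub_eq, norm_sderiv_bgVec_le}` (p313042) with p14 g10's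
`B1Ineq225DerivZeroFieldTorus.covDeriv_propagatorK_sup_bound`, p23/r15's `B1Eq31Concrete.bgVec` (`A^{(k),ε}` of (3.29)),
`B1Eq211ZeroFieldTorus.Shape`.

WHAT IS PRINTED (verbatim).  [B1] p. 611 [PDF 9]: *"Proposition 2.3. If a configuration A is regular on Ω in the sense defined
in Proposition 2.1, then there exist positive constants δ₀, c₀, γ₀, γ₁ dependent on d and a, and independent of A, k, Ω and
Λ, such that γ₀I ≦ aL^{−2}P(A) + Δ^{(k)}(Ω, A) ≦ γ₁I, (2.33)"*; p. 610 [PDF 8]: *"let a configuration A be regular on Ω in the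
sense that |(∂^η_μA^η_ν)(x)| ≦ c e(L^kε)^{β−1}, x ∈ Ω (2.23)"*; p. 617 [PDF 15], (3.29): *"A^{(k),ε} = a_k(L^kε)^{−2}G^ε_kQ^*_kA"*;
p. 608 [PDF 6]: *"(Q(A)φ)(y) = Σ_{x∈B(y)} U(A(Γ_{y,x}))φ(x) (2.7)"*, *"A(Γ) = Σ_{b⊂Γ} εA_b (2.3)"*.  [B4] p. 593 [PDF 23]: *"To
prove the lower bound we apply Proposition II.3.1′ to Δ^{(k)}(Ω, A): ⟨φ, (Δ^{(k)}(Ω, A) + aL^{−2}P(A))φ⟩ ≧ γ₀Σ_{⟨x,x′⟩⊂Ω^{(k)}}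
|U(A(⟨x, x′⟩))φ(x′) − φ(x)|² + aL^{d−2}Σ_{y∈Ω^{(k+1)}}|L^{−d}Σ_{x∈B(y)}U(A(Γ_{y,x}))φ(x)|² − O(e^{2−δ})Σ_{x∈Ω^{(k)}}|φ(x)|². (5.2)
Now we use again the method we have applied so many times: in the expression on the right hand side above we separate the
blocks by Neumann boundary conditions, in each block we decompose A = A₀ + A′ into a constant field A₀ and small field A′ and
we expand with respect to A′ getting the same expression with A₀ instead of A and a bigger constant in the last sum. Next we
“gauge away” the constant field, and we obtain the Laplace operator with Neumann boundary conditions for each block plus the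
projection operator on constant functions. This sum is bounded from below by a positive constant (more precisely by
½γ₀min{π²L^{−2}, aL^{−2}}), thus we have ⟨φ, (Δ^{(k)}(Ω, A) + aL^{−2}P(A))φ⟩ ≧ γ₀′⟨φ, φ⟩ − O(e^{2−δ})⟨φ, φ⟩ ≧ γ₀″⟨φ, φ⟩. (5.3)
for e sufficiently small and we get the lower bound."*; p. 574 [PDF 4]: *"Proposition 3.1′ of [2]. Let Ω be a sum of unit blocks
… and let A satisfies the condition |(∂^η_μA)(x)| ≦ O(1)p(e) (1.21) then there exists a positive constant γ₀ depending on d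
only, such that for e sufficiently small ⟨φ, Δ^{(k)}(Ω,A)φ⟩ ≧ γ₀(Σ_{⟨x,x′⟩⊂Ω^{(k)}}|U(A(⟨x,x′⟩))φ(x′) − φ(x)|² +
m²Σ_{x∈Ω^{(k)}}|φ(x)|²) − O(1)e^{2−α}Σ_{x∈Ω^{(k)}}|φ(x)|² (1.22)"*; p. 580 [PDF 10], (2.27): *"The operator −Δ^{η,N}_Δ is bounded
from below … on a subspace of functions on Δ orthogonal to constant functions"*; p. 590 [PDF 20]: *"Using the regularity
condition for A, we write A = A₀ + A′ on Δ(x,x′) with A₀ constant and A′ satisfying the bounds |A′|, |∂^η_μA′| ≦ O(1)p(e)"*.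

DICTIONARY (as in r14 g7's `B1Ineq233LowerZeroField(Torus)`, p23's `B2Ineq329RegularField` and p35's `B1Ineq225BackgroundTorus`;
NO rescaling to the unit lattice).  `Ω = T_ε` (`Finset.univ`); `aL^{−2}P(A) + Δ^{(k)}(Ω, A)` ↦ r14's
`B1Eq230FluctCov.precOpA C univ A m² a k = a(L^{k+1}ε)^{−2}P(A) + Δ^{(k),L^kε}(T_ε, A)` with `P(A) = Q^*(A)Q(A)` (`blockProjA`,
the one-step (2.7) averaging `B1Eq27StepAdjoint.avgQLin`) and the solved (2.21) operator `deltaKA`; `γ₀I ≦ …` on the unit lattice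
↦ `γ·(L^kε)^{−2}‖ψ‖² ≦ ⟨ψ, precOpA ψ⟩` in the (1.5) product `siteInner`; «A regular on Ω in the sense of Proposition 2.1»
((2.23), = [B4] (1.21)) ↦ the lattice-units form of p23: `|Ã⟨z + εe_ν, μ′⟩ − Ã⟨z, μ′⟩| ≦ δ` for all `z ∈ T_ε`, `μ′, ν`
(`(L^kε)(L^kδ) = e·(printed bound)`); «e sufficiently small» ↦ three explicit smallness conditions on `L^kδ`
(`ineq233_lower_regular_torus`: p23's `8d⁴L^d e²(L^kε)²(L^kδ)² ≦ ½`, `64γ₀d³e²(L^kδ)²(L^kε)² ≦ c₁/4`, `L²d·θ² ≦ 1`,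
`θ = 2dL·L^{2k}ε|e|δ`), which at the background `A^{(k),ε}` (`bgVec μ₀² a k A`, `|A| ≦ r`, `L^kδ = a c′ r` by p35) all read
`O(1)·(a c′·rL^kε)² ≦ const` ↦ the threshold `r·L^kε ≦ c_A`; the bond sum of (5.2)/(1.22) `Σ|U(A(⟨x,x′⟩))φ(x′) − φ(x)|²` ↦
`(L^kε)²⟨D_{Ā^{(k)}}ψ, D_{Ā^{(k)}}ψ⟩` (`bondInner` of `covDeriv C (barA k A) ψ`, the coarse bond variable `Ā^{(k)}` of (II.2.55) —
p23's dictionary, `B2Ineq329RegularField.bondKA_eq_sum_printed`); the block term `aL^{d−2}Σ_y|L^{−d}Σ_{x∈B(y)}U(A(Γ_{y,x}))φ(x)|²`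
↦ `a(L^{k+1}ε)^{−2}⟨ψ, P(A)ψ⟩` (`siteInner_blockProjA_transport`); «gauge away» ↦ the field `ψ′(x) = U(A(Γ_{y,x}))ψ(x)`, `y` the
block point of `x`; «decompose A = A₀ + A′ … expand with respect to A′» ↦ the EXACT one-step holonomy bound
`|A(Γ_{y,x+e_μ}) − A(Γ_{y,x}) − A([x̃, x̃ + L^kεe_μ])| ≦ 2dL·L^{2k}δ` (`abs_hol_block_le`; no expansion); «Laplace operator with
Neumann boundary conditions for each block plus the projection … bounded from below» ↦ r14 g7's block Poincaré inequality
`B1Ineq233LowerZeroField.block_poincare_vec` (gap constant `8`, census G-B4-03, in place of `π²`).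

WHAT THIS FILE PROVES (kernel-checked, zero `sorry`, standard axioms; theorems only — no definition, no `Prop`-valued fact):
* §1 (staircases under translation) `segSum_add`, `abs_segSum_shift_sub_le` / `abs_segSum_shiftN_sub_le` (a translation by
  `tεe_ν` moves a straight-segment sum of `n` bonds by `≦ t·n·δ`), `corner_shiftN_right_of_le/lt`, **`abs_hol_oneStep_le`**:
  `|A(Γ_{Y,X+nεe_μ}) − A(Γ_{Y,X}) − A([X, X + nεe_μ])| ≦ 2n(Σ_ν m_ν)δ` when the `μ`-segment does not wrap (`m_ν` the step counts).
* §2 (block geometry) `toFinest_shift` (`(x + e_μ)~ = x̃ + L^kεe_μ`), `val_corner_sub` (`x̃_ν − ỹ_ν = L^k(x_ν mod L)`),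
  `sum_val_corner_sub_le`, `val_shiftN_corner_sub` (no wrap-around when `|T^{(k+1)}|_μ ≧ 2`), **`abs_hol_block_le`**:
  `|A(Γ_{y,x+e_μ}) − A(Γ_{y,x}) − A([x̃, x̃ + L^kεe_μ])| ≦ 2dL·L^{2k}·δ` (`k < K`).
* §3 `siteInner_blockProjA_transport` (`⟨ψ, P(A)ψ⟩ = (L^kε)^dL^{−d}Σ_y‖Σ_{x∈B(y)}ψ′(x)‖²`), `norm_transport_bond_sub_le`
  (`‖ψ′(x+e_μ) − ψ′(x)‖ ≦ L^kε‖(D_{Ā^{(k)}}ψ)(b)‖ + θ‖ψ(x+e_μ)‖`), **`siteInner_self_le_blockProjA_add_cov`** (THE COVARIANT BLOCK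
  POINCARÉ INEQUALITY): `‖ψ‖² ≦ ⟨ψ, P(A)ψ⟩ + (L²/4)(L^kε)²⟨D_{Ā^{(k)}}ψ, D_{Ā^{(k)}}ψ⟩ + (L²/4)dθ²‖ψ‖²` for EVERY `ψ`, every `A`
  `δ`-regular on `T_ε` (`k < K`, `|T^{(k+1)}|_μ ≧ 2`).
* §4 `delta_lower_regular` ((II.3.29) at a regular `Ã` on the whole torus, transport of p23's theorem to `Λ_k = T^{(k)}`),
  **`ineq233_lower_regular_torus`**: under the three smallness conditions, for EVERY `ψ : T^{(k)} → ℝ^N` (`k = j+1 < K`,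
  `L^kε ≦ 1`), `(c₁/2)(L^kε)^{−2}‖ψ‖² ≦ ⟨ψ, (a(L^{k+1}ε)^{−2}P(Ã) + Δ^{(k),L^kε}(T_ε, Ã))ψ⟩`, `c₁ = min{a, 4γ₀}/L²`, `γ₀` p23's
  (3.29)-constant (`γ₀(8d + 2m² + 4) ≦ a(1 − L^{−2})`, `γ₀ ≦ 1/16`) — uniform in `k`, the volume, `ε` and `Ã`.
* §5 `abs_bgVec_shift_sub_le` (the (2.23)-regularity of `A^{(k),ε}` in lattice units, from p35 + p14),
  **`ineq233_lower_bgVec_torus`**: `∃ γ > 0, c_A > 0` (functions of `d, L, a, μ₀², m², e`) such that on the torus sub-family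
  (`Shape`, `P.d = d`, `P.L = L`), for every `1 ≦ k < K_P` with `|T^{(k+1)}|_μ ≧ 2`, `L^kε ≦ 1`, every `A : T^{(k)} → ℝ^d` with
  `|A| ≦ r`, `r·L^kε ≦ c_A`, and EVERY `ψ`: `γ(L^kε)^{−2}‖ψ‖² ≦ ⟨ψ, (a(L^{k+1}ε)^{−2}P(A^{(k),ε}) + Δ^{(k),L^kε}(T_ε, A^{(k),ε}))ψ⟩`.
* §6 (v1.1) `siteInner_deltaKA_levelZero_cov` (`⟨ψ, Δ^{(0),ε}(T_ε,A)ψ⟩ = ⟨D_Aψ, D_Aψ⟩ + m²‖ψ‖²`, every `A`),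
  **`ineq233_lower_regular_torus_levelZero`**: level `k = 0`, `A` `δ`-regular with `L²dθ₀² ≦ 1` (`θ₀ = 2dL·ε|e|δ`), `a, m² ≧ 0`:
  `(3c₁⁰/4)ε^{−2}‖ψ‖² ≦ ⟨ψ, (a(Lε)^{−2}P(A) + (−Δ^ε_A + m²))ψ⟩`, `c₁⁰ = min{a, 4}/L²` — no `(L^kδ)²`-error, no `ε ≦ 1`.
* §7 (v1.2) **`ineq233_lower_printed_torus`** — THE PRINTED SHAPE for a general regular `A`: for `d, L, a, m²` and a regularity constant
  `c` there are `E₀ > 0`, `γ > 0` (functions of `d, L, a, m², c` only) such that for every charge with `e² ≦ E₀` («for e sufficiently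
  small»), every torus, every `1 ≦ k < K_P` with `L^kε ≦ 1`, every `A` `δ`-regular on `T_ε` with `L^k·δ ≦ c·|e|` ((2.23) in lattice units,
  `β ≧ 0`) and every `ψ`: `γ(L^kε)^{−2}‖ψ‖² ≦ ⟨ψ, (a(L^{k+1}ε)^{−2}P(A) + Δ^{(k),L^kε}(T_ε, A))ψ⟩`.
HONEST SCOPE.  (i) `Ω = T_ε` only (the printed «case Ω = T_ε only», p. 610); levels `1 ≦ k < K_P` in §4–§5, §7 and `k = 0` in §6
(v1.1; at level `0` the background of (3.2) is the fine field `A₀` itself, regular by (2.55)₀ — §6 is stated for any `δ`-regular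
`A`); the hypothesis `|T^{(k+1)}|_μ ≧ 2` excludes the degenerate torus with a single coarse block per direction (where the
one-step loop is a Polyakov loop and the holonomy is not small) — it holds whenever `k + 1 < K_P` or `L′_μ ≧ 2`.  (ii) Constant:
printed `½γ₀min{π²L^{−2}, aL^{−2}}` (5.3) vs. ours `½·min{aL^{−2}, 4γ₀L^{−2}}` — block Poincaré constant `8` for `π²` (census
G-B4-03) and a factor `2` lost in separating the holonomy; `γ₀` is p23's explicit (3.29)-constant, not the printed unspecified one.
(iii) The printed error `O(e^{2−δ})` is p23's explicit `64γ₀d³e²(L^kδ)²` plus the holonomy term `(L²/4)dθ²`; «e sufficiently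
small» is the explicit threshold `c_A` on `r·L^kε` at the background (3.29) (p35's reading of (2.23) for `A^{(k),ε}`), no claim for
other regular `A` beyond the explicit hypotheses of §4.  (iv) (2.33) upper half is r14 g6's `B1Ineq233Upper` (every `A`); the
(2.34)/(2.36) decay at `A^{(k),ε}` (g7's engine fed with this `hlow` and g13's `B1Ineq227BackgroundTorus`) is the next file, not
this one.  (v) Value = kernel certificate of the printed [B4] §5 mechanism for the concrete objects at the first `A ≠ 0`
background of the (Higgs)₂,₃ construction; NOT summit progress.  Unit `lit-balaban-r14-g13` (literature-prover-lit-balaban-r14-g13-0);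
HOME/FILED.md records the proposal.
-/

noncomputable section

open scoped BigOperators InnerProductSpace
open Finset

namespace Literature.MathematicalPhysics.QuantumFieldTheory.Balaban1983to89.B1Ineq233LowerBackgroundTorus

open HiggsLattice HiggsAveraging HiggsCovariance HiggsCovariancePos B1Eq230FluctCov B1Eq230FluctCovPos
open B2Ineq329ZeroAveraging (shiftN_apply_self shiftN_apply_ne shiftN_add shiftN_zero' shift_shiftN sitesPerDir_zero_eq)
open B2Ineq329PrismHolonomy (shift_shiftN_comm val_toFinest corner_eq_cornerN shiftN_cornerN_succ abs_sub_le_of_stair)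
open B2Restr216Lattice (cornerN val_blockOf norm_U_apply sitesPerDir_eq_mul)
open B2Ineq329CovariantAveraging (norm_U_apply_sub_le U_apply_U U_mesh_barA sum_inside_tgt_le)
open B2Eq255Concrete (barA)
open B1Eq27StepAdjoint (avgQLin avgQLin_apply mesh_succ_pow_mul)
open B1Ineq233LowerZeroField (block_poincare_vec sum_ite_inside_block_le mesh_succ)
open HiggsFluctMeasurePos (siteInner_add_right siteInner_smul_right)

variable {P : HiggsLattice.Params} {N : ℕ}

/-! ## §1 Straight segments under translation; the one-step staircase holonomy -/

section Staircase

variable (A : HiggsLattice.VecField P 0)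

/-- `A([u, u + (m+n)εe_μ]) = A([u, u + mεe_μ]) + A([u + mεe_μ, u + (m+n)εe_μ])`. [cite: Balaban1982Higgs1, (2.3) p.608] -/
theorem segSum_add (u : HiggsLattice.Site P 0) (μ : Fin P.d) (m n : ℕ) :
    segSum A u μ (m + n) = segSum A u μ m + segSum A (shiftN u μ m) μ n := by
  unfold segSum
  rw [Finset.sum_range_add]
  congr 1
  refine Finset.sum_congr rfl fun i _ => ?_
  rw [shiftN_add]

variable {A}

/-- **A unit translation moves a straight-segment sum by at most (length)·δ** when the field is `δ`-regular
(`|A(b + εe_ν) − A(b)| ≤ δ` for all bonds, (1.21) of [B4] in lattice units). [cite: Balaban1983RegularityDecay, (1.21) p.574]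
[cite: Balaban1982Higgs1, (2.3) p.608] -/
theorem abs_segSum_shift_sub_le {δ : ℝ}
    (hreg : ∀ (z : HiggsLattice.Site P 0) (μ' ν : Fin P.d), |A ⟨z.shift ν, μ'⟩ - A ⟨z, μ'⟩| ≤ δ)
    (u : HiggsLattice.Site P 0) (μ ν : Fin P.d) (n : ℕ) :
    |segSum A (u.shift ν) μ n - segSum A u μ n| ≤ n * δ := by
  unfold segSum
  rw [← Finset.sum_sub_distrib]
  refine (Finset.abs_sum_le_sum_abs _ _).trans ?_
  calc ∑ i ∈ Finset.range n, |A ⟨shiftN (u.shift ν) μ i, μ⟩ - A ⟨shiftN u μ i, μ⟩|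
      ≤ ∑ _i ∈ Finset.range n, δ := Finset.sum_le_sum fun i _ => by
        rw [← shift_shiftN_comm]
        exact hreg _ μ ν
    _ = n * δ := by rw [Finset.sum_const, Finset.card_range, nsmul_eq_mul]

/-- **A translation by `tεe_ν` moves a straight-segment sum of `n` bonds by at most `t·n·δ`.** [cite: Balaban1983RegularityDecay, (1.21) p.574]
[cite: Balaban1982Higgs1, (2.3) p.608] -/
theorem abs_segSum_shiftN_sub_le {δ : ℝ}
    (hreg : ∀ (z : HiggsLattice.Site P 0) (μ' ν : Fin P.d), |A ⟨z.shift ν, μ'⟩ - A ⟨z, μ'⟩| ≤ δ)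
    (u : HiggsLattice.Site P 0) (μ ν : Fin P.d) (n t : ℕ) :
    |segSum A (shiftN u ν t) μ n - segSum A u μ n| ≤ t * n * δ := by
  induction t with
  | zero => simp [shiftN_zero']
  | succ t ih =>
    rw [← shift_shiftN]
    calc |segSum A ((shiftN u ν t).shift ν) μ n - segSum A u μ n|
        ≤ |segSum A ((shiftN u ν t).shift ν) μ n - segSum A (shiftN u ν t) μ n|
            + |segSum A (shiftN u ν t) μ n - segSum A u μ n| := abs_sub_le _ _ _
      _ ≤ n * δ + t * n * δ := add_le_add (abs_segSum_shift_sub_le hreg _ μ ν n) ih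
      _ = ((t + 1 : ℕ) : ℝ) * n * δ := by push_cast; ring

/-- Moving the fine endpoint `X` of the staircase (2.1) by `T` steps in direction `μ` does not change the corners with index `i ≥ μ`
(their `μ`-coordinate is `y_μ`). [cite: Balaban1982Higgs1, (2.1) p.608] -/
theorem corner_shiftN_right_of_le (Y X : HiggsLattice.Site P 0) {μ i : Fin P.d} (h : μ ≤ i) (T : ℕ) :
    corner Y (shiftN X μ T) i = corner Y X i := by
  funext j
  by_cases hj : j = μ
  · subst hj
    simp [corner, h]
  · simp [corner, shiftN_apply_ne _ hj]

/-- … and translates the corners with index `i < μ` by the same vector (their `μ`-coordinate is `x_μ`). [cite: Balaban1982Higgs1, (2.1) p.608] -/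
theorem corner_shiftN_right_of_lt (Y X : HiggsLattice.Site P 0) {μ i : Fin P.d} (h : i < μ) (T : ℕ) :
    corner Y (shiftN X μ T) i = shiftN (corner Y X i) μ T := by
  funext j
  by_cases hj : j = μ
  · subst hj
    have : ¬ j ≤ i := not_le.mpr h
    simp [corner, this, shiftN_apply_self]
  · simp [corner, shiftN_apply_ne _ hj]

/-- **THE ONE-STEP PRISM HOLONOMY.**  For the staircase contours (2.1) from a common coarse corner `Y` to `X` and to
`X′ = X + nεe_μ`, and the straight segment `[X, X′]`, if the `μ`-segment of `Γ_{Y,X′}` is that of `Γ_{Y,X}` prolonged by `n`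
steps (no wrap-around: `(x′_μ − y_μ) = (x_μ − y_μ) + n`), then for a `δ`-regular field
`|A(Γ_{Y,X′}) − A(Γ_{Y,X}) − A([X, X′])| ≤ 2n·(Σ_ν m_ν)·δ`, `m_ν = x_ν − y_ν` the step counts of `Γ_{Y,X}` — the two staircases agree up
to the `μ`-segment, whose prolongation is the segment `[X, X′]` translated along the tail of `Γ_{Y,X}`, and differ after it by the
translation `nεe_μ` of the tail (the [B4] device *"A = A₀ + A′ … expand with respect to A′"* (p. 590, p. 593) in the exact form of
p23's `abs_hol_le`). [cite: Balaban1983RegularityDecay, §4 p.590, §5 (5.2)–(5.3) p.593] [cite: Balaban1982Higgs1, (2.1)–(2.3) p.608] -/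
theorem abs_hol_oneStep_le {δ : ℝ} (hδ : 0 ≤ δ)
    (hreg : ∀ (z : HiggsLattice.Site P 0) (μ' ν : Fin P.d), |A ⟨z.shift ν, μ'⟩ - A ⟨z, μ'⟩| ≤ δ)
    (Y X : HiggsLattice.Site P 0) (μ : Fin P.d) (n : ℕ)
    (hwrap : ((shiftN X μ n) μ - Y μ).val = (X μ - Y μ).val + n) :
    |contourSum A Y (shiftN X μ n) - contourSum A Y X - segSum A X μ n|
      ≤ 2 * n * (∑ ν : Fin P.d, ((X ν - Y ν).val : ℝ)) * δ := by
  classical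
  -- notation
  set S : Fin P.d → ℝ := fun i => segSum A (corner Y X i) i (X i - Y i).val with hS
  set S' : Fin P.d → ℝ := fun i => segSum A (corner Y (shiftN X μ n) i) i ((shiftN X μ n) i - Y i).val with hS'
  set m : Fin P.d → ℝ := fun ν => ((X ν - Y ν).val : ℝ) with hm
  have hm0 : ∀ ν, 0 ≤ m ν := fun ν => Nat.cast_nonneg _
  have hn0 : (0 : ℝ) ≤ n := Nat.cast_nonneg _
  -- (a) the terms `i ≠ μ`
  have hD : ∀ i, i ≠ μ → |S' i - S i| ≤ n * m i * δ := by
    intro i hi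
    have hstep : ((shiftN X μ n) i - Y i).val = (X i - Y i).val := by rw [shiftN_apply_ne _ hi]
    rcases lt_or_gt_of_ne hi with hlt | hgt
    · -- `i < μ`: corner translated, same steps
      rw [hS', hS]
      dsimp only
      rw [hstep, corner_shiftN_right_of_lt Y X hlt]
      exact abs_segSum_shiftN_sub_le hreg _ i μ _ n
    · -- `μ < i`: identical terms
      rw [hS', hS]
      dsimp only
      rw [hstep, corner_shiftN_right_of_le Y X hgt.le, sub_self, abs_zero]
      exact mul_nonneg (mul_nonneg hn0 (hm0 i)) hδ
  -- (b) the `μ`-term: prolongation by the translated segment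
  have hDμ : S' μ - S μ = segSum A (cornerN Y X μ) μ n := by
    rw [hS', hS]
    dsimp only
    rw [hwrap, corner_shiftN_right_of_le Y X le_rfl, segSum_add, corner_eq_cornerN, shiftN_cornerN_succ]
    ring
  have hτ : |segSum A (cornerN Y X μ) μ n - segSum A X μ n| ≤ (∑ ν, m ν) * (n * δ) := by
    rw [abs_sub_comm]
    have h := abs_sub_le_of_stair (fun q => segSum A q μ n) (cornerN Y X μ) X (δ := n * δ)
      (fun ν s _ => abs_segSum_shift_sub_le hreg _ μ ν n)
    refine h.trans (mul_le_mul_of_nonneg_right (Finset.sum_le_sum fun ν _ => ?_) (mul_nonneg hn0 hδ))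
    -- the staircase from `cornerN μ` to `X` has steps `m_ν` for `ν < μ` and `0` otherwise
    rw [hm]
    dsimp only [cornerN]
    split_ifs with hν
    · exact le_rfl
    · rw [sub_self, ZMod.val_zero, Nat.cast_zero]
      exact Nat.cast_nonneg _
  -- (c) assemble
  have hsum : contourSum A Y (shiftN X μ n) - contourSum A Y X - segSum A X μ n
      = (S' μ - S μ - segSum A X μ n) + ∑ i ∈ Finset.univ.erase μ, (S' i - S i) := by
    unfold contourSum
    rw [show (∑ i, segSum A (corner Y (shiftN X μ n) i) i ((shiftN X μ n) i - Y i).val) = ∑ i, S' i from rfl,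
      show (∑ i, segSum A (corner Y X i) i (X i - Y i).val) = ∑ i, S i from rfl,
      ← Finset.sum_sub_distrib, ← Finset.add_sum_erase _ _ (Finset.mem_univ μ)]
    ring
  rw [hsum, hDμ]
  calc |segSum A (cornerN Y X μ) μ n - segSum A X μ n + ∑ i ∈ Finset.univ.erase μ, (S' i - S i)|
      ≤ |segSum A (cornerN Y X μ) μ n - segSum A X μ n| + |∑ i ∈ Finset.univ.erase μ, (S' i - S i)| := abs_add_le _ _
    _ ≤ (∑ ν, m ν) * (n * δ) + ∑ i ∈ Finset.univ.erase μ, n * m i * δ := by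
        refine add_le_add hτ ((Finset.abs_sum_le_sum_abs _ _).trans (Finset.sum_le_sum fun i hi => ?_))
        exact hD i (Finset.ne_of_mem_erase hi)
    _ ≤ (∑ ν, m ν) * (n * δ) + ∑ i, n * m i * δ := by
        refine add_le_add le_rfl (Finset.sum_le_sum_of_subset_of_nonneg (Finset.erase_subset _ _) fun i _ _ => ?_)
        exact mul_nonneg (mul_nonneg hn0 (hm0 i)) hδ
    _ = 2 * n * (∑ ν, m ν) * δ := by rw [← Finset.sum_mul, ← Finset.mul_sum]; ring

end Staircase

/-! ## §2 The block geometry of `T^{(k)} ⊂ T_ε`: corners, step counts, no wrap-around -/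

section Geometry

variable {k : ℕ}

/-- **The corner of the next block point**: `(x + e_μ)~ = x~ + Lᵏ·εe_μ` (`k ≤ K`; labels `v ↦ Lᵏv`, exact in `ℤ/|T_ε|_μ`).
[cite: Balaban1982Higgs1, (1.20) p.607] -/
theorem toFinest_shift (hk : k ≤ P.K) (x : HiggsLattice.Site P k) (μ : Fin P.d) :
    toFinest (x.shift μ) = shiftN (toFinest x) μ (P.L ^ k) := by
  funext ν
  by_cases hν : ν = μ
  · subst hν
    rw [shiftN_apply_self]
    simp only [toFinest, HiggsLattice.Site.shift, Function.update_self]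
    rw [← Nat.cast_add, ZMod.natCast_eq_natCast_iff', sitesPerDir_zero_eq hk ν, ZMod.val_add, ZMod.val_one_eq_one_mod,
      Nat.add_mod_mod, mul_comm (P.L ^ k) (P.sitesPerDir k ν), Nat.mul_mod_mul_right,
      show (x ν).val * P.L ^ k + P.L ^ k = ((x ν).val + 1) * P.L ^ k by ring, Nat.mul_mod_mul_right, Nat.mod_mod]
  · rw [shiftN_apply_ne _ hν]
    simp only [toFinest, HiggsLattice.Site.shift, Function.update_of_ne hν]

/-- **The step counts of the one-step staircase `Γ_{y,x}`, `y = x_{k+1}`**: `x~_ν − y~_ν = Lᵏ·(x_ν mod L)` (`k < K`), hence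
`≤ (L − 1)Lᵏ`. [cite: Balaban1982Higgs1, (1.17) p.606, (2.1) p.608] -/
theorem val_corner_sub (hk : k < P.K) (x : HiggsLattice.Site P k) (ν : Fin P.d) :
    ((toFinest x) ν - (toFinest (HiggsLattice.blockOf x)) ν).val = P.L ^ k * ((x ν).val % P.L) := by
  have hX : ((toFinest x) ν).val = (x ν).val * P.L ^ k := val_toFinest hk.le x ν
  have hY : ((toFinest (HiggsLattice.blockOf x)) ν).val = (x ν).val / P.L * P.L ^ (k + 1) := by
    rw [val_toFinest (i := k + 1) hk, val_blockOf hk]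
  have e : (x ν).val * P.L ^ k = (x ν).val / P.L * P.L ^ (k + 1) + P.L ^ k * ((x ν).val % P.L) := by
    nth_rewrite 1 [← Nat.div_add_mod (x ν).val P.L]
    ring
  have hle : ((toFinest (HiggsLattice.blockOf x)) ν).val ≤ ((toFinest x) ν).val := by
    rw [hX, hY, e]; exact Nat.le_add_right _ _
  rw [ZMod.val_sub hle, hX, hY, e, Nat.add_sub_cancel_left]

/-- The total length of the one-step staircase is `≤ d(L − 1)Lᵏ ≤ d·L·Lᵏ`. [cite: Balaban1982Higgs1, (2.1) p.608] -/
theorem sum_val_corner_sub_le (hk : k < P.K) (x : HiggsLattice.Site P k) :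
    ∑ ν : Fin P.d, (((toFinest x) ν - (toFinest (HiggsLattice.blockOf x)) ν).val : ℝ) ≤ P.d * P.L * (P.L : ℝ) ^ k := by
  calc ∑ ν : Fin P.d, (((toFinest x) ν - (toFinest (HiggsLattice.blockOf x)) ν).val : ℝ)
      ≤ ∑ _ν : Fin P.d, (P.L : ℝ) * (P.L : ℝ) ^ k := Finset.sum_le_sum fun ν _ => by
        rw [val_corner_sub hk]
        have hlt : (x ν).val % P.L < P.L := Nat.mod_lt _ P.hL
        have : ((P.L ^ k * ((x ν).val % P.L) : ℕ) : ℝ) ≤ ((P.L ^ k * P.L : ℕ) : ℝ) := by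
          exact_mod_cast Nat.mul_le_mul_left _ hlt.le
        refine this.trans_eq ?_
        push_cast; ring
    _ = P.d * P.L * (P.L : ℝ) ^ k := by rw [Finset.sum_const, Finset.card_univ, Fintype.card_fin, nsmul_eq_mul]; ring

/-- **No wrap-around** when `T^{(k+1)}` has at least two sites in direction `μ`: the `μ`-coordinate of `(x + e_μ)~` relative to the
corner of the `(k+1)`-block of `x` is that of `x~` plus `Lᵏ`. [cite: Balaban1982Higgs1, (1.17) p.606, (1.20) p.607] -/
theorem val_shiftN_corner_sub (hk : k < P.K) {μ : Fin P.d} (hN2 : 2 ≤ P.sitesPerDir (k + 1) μ) (x : HiggsLattice.Site P k) :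
    ((shiftN (toFinest x) μ (P.L ^ k)) μ - (toFinest (HiggsLattice.blockOf x)) μ).val
      = ((toFinest x) μ - (toFinest (HiggsLattice.blockOf x)) μ).val + P.L ^ k := by
  have hn0 : P.sitesPerDir 0 μ = P.L ^ k * (P.L * P.sitesPerDir (k + 1) μ) := by
    rw [sitesPerDir_zero_eq hk.le μ, sitesPerDir_eq_mul hk μ]
  have hLk : 0 < P.L ^ k := pow_pos P.hL k
  have hlt : ((toFinest x) μ - (toFinest (HiggsLattice.blockOf x)) μ).val + P.L ^ k < P.sitesPerDir 0 μ := by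
    rw [val_corner_sub hk, hn0]
    have hr : (x μ).val % P.L + 1 ≤ P.L := Nat.mod_lt _ P.hL
    calc P.L ^ k * ((x μ).val % P.L) + P.L ^ k = P.L ^ k * ((x μ).val % P.L + 1) := by ring
      _ ≤ P.L ^ k * P.L := Nat.mul_le_mul_left _ hr
      _ < P.L ^ k * (P.L * P.sitesPerDir (k + 1) μ) := by
          apply Nat.mul_lt_mul_of_pos_left _ hLk
          calc P.L = P.L * 1 := (mul_one _).symm
            _ < P.L * P.sitesPerDir (k + 1) μ := Nat.mul_lt_mul_of_pos_left (by omega) P.hL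
  have hcast : ((P.L ^ k : ℕ) : ZMod (P.sitesPerDir 0 μ)).val = P.L ^ k := by
    rw [ZMod.val_natCast_of_lt]
    omega
  rw [shiftN_apply_self, add_sub_right_comm, ZMod.val_add_of_lt, hcast]
  rw [hcast]
  exact hlt

/-- **The one-step holonomy inside a block**: for `x ∈ T^{(k)}` (`k < K`, at least two `(k+1)`-sites per direction), the staircases
(2.7) from the corner of the `(k+1)`-block of `x` to `x~` and to `(x + e_μ)~` and the straight coarse bond `[x~, x~ + Lᵏεe_μ]` of
(II.2.55) have circulation `|A(Γ_{y,x+e_μ}) − A(Γ_{y,x}) − A([x~, x~ + Lᵏεe_μ])| ≤ 2dL·L^{2k}·δ` for a `δ`-regular `A`.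
[cite: Balaban1983RegularityDecay, §5 (5.2)–(5.3) p.593, §4 p.590] [cite: Balaban1982Higgs1, (2.7) p.608] -/
theorem abs_hol_block_le (hk : k < P.K) (hN2 : ∀ μ, 2 ≤ P.sitesPerDir (k + 1) μ) {A : HiggsLattice.VecField P 0} {δ : ℝ}
    (hδ : 0 ≤ δ) (hreg : ∀ (z : HiggsLattice.Site P 0) (μ' ν : Fin P.d), |A ⟨z.shift ν, μ'⟩ - A ⟨z, μ'⟩| ≤ δ)
    (x : HiggsLattice.Site P k) (μ : Fin P.d) :
    |contourSum A (toFinest (HiggsLattice.blockOf x)) (toFinest (x.shift μ))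
        - contourSum A (toFinest (HiggsLattice.blockOf x)) (toFinest x) - segSum A (toFinest x) μ (P.L ^ k)|
      ≤ 2 * P.d * P.L * ((P.L : ℝ) ^ k) ^ 2 * δ := by
  rw [toFinest_shift hk.le]
  have h := abs_hol_oneStep_le hδ hreg (toFinest (HiggsLattice.blockOf x)) (toFinest x) μ (P.L ^ k)
    (val_shiftN_corner_sub hk (hN2 μ) x)
  refine h.trans ?_
  have hs := sum_val_corner_sub_le hk x
  have hn : (0 : ℝ) ≤ ((P.L ^ k : ℕ) : ℝ) := Nat.cast_nonneg _
  push_cast at hn ⊢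
  calc 2 * (P.L : ℝ) ^ k * (∑ ν : Fin P.d, (((toFinest x) ν - (toFinest (HiggsLattice.blockOf x)) ν).val : ℝ)) * δ
      ≤ 2 * (P.L : ℝ) ^ k * (P.d * P.L * (P.L : ℝ) ^ k) * δ :=
        mul_le_mul_of_nonneg_right (mul_le_mul_of_nonneg_left hs (by positivity)) hδ
    _ = 2 * P.d * P.L * ((P.L : ℝ) ^ k) ^ 2 * δ := by ring

end Geometry

/-! ## §3 The covariant block Poincaré inequality at level `k` -/

section CovPoincare

variable (C : ChargeData N) {k : ℕ}

/-- **`⟨ψ, P(A)ψ⟩` through the block transports**: with `ψ′(x) = U(A(Γ_{y,x}))ψ(x)`, `y` the block point of `x` (the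
transports of (2.7)), `⟨ψ, P(A)ψ⟩ = (Lᵏε)^d·L^{−d}·Σ_y ‖Σ_{x∈B(y)} ψ′(x)‖²` (`⟨ψ, P(A)ψ⟩ = ‖Q(A)ψ‖²`,
`B1Eq230FluctCovPos.siteInner_blockProjA_eq`). [cite: Balaban1982Higgs1, (2.7) p.608, (2.30) p.611] -/
theorem siteInner_blockProjA_transport (A : HiggsLattice.VecField P 0) (ψ : ScalarField P k N) :
    siteInner ψ (blockProjA C A k ψ)
      = P.mesh k ^ P.d * (((P.L : ℝ) ^ P.d)⁻¹ * ∑ y : HiggsLattice.Site P (k + 1),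
          ‖∑ x ∈ HiggsLattice.block y,
              C.U (P.mesh 0) (contourSum A (toFinest (HiggsLattice.blockOf x)) (toFinest x)) (ψ x)‖ ^ 2) := by
  rw [siteInner_blockProjA_eq, siteInner]
  have hL : (0 : ℝ) < (P.L : ℝ) ^ P.d := pow_pos (by exact_mod_cast P.hL) _
  have hmesh : P.mesh (k + 1) ^ P.d = P.mesh k ^ P.d * (P.L : ℝ) ^ P.d := by
    rw [← mesh_succ_pow_mul k, mul_assoc, inv_mul_cancel₀ hL.ne', mul_one]
  have hblk : ∀ y : HiggsLattice.Site P (k + 1), avgQLin C A k ψ y = ((P.L : ℝ) ^ P.d)⁻¹ •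
      ∑ x ∈ HiggsLattice.block y,
        C.U (P.mesh 0) (contourSum A (toFinest (HiggsLattice.blockOf x)) (toFinest x)) (ψ x) := by
    intro y
    rw [avgQLin_apply, avgQ_apply]
    congr 1
    refine Finset.sum_congr rfl fun x hx => ?_
    have hxy : HiggsLattice.blockOf x = y := by
      simpa only [HiggsLattice.block, Finset.mem_filter, Finset.mem_univ, true_and] using hx
    rw [hxy]
  simp_rw [hblk, real_inner_self_eq_norm_sq, norm_smul, mul_pow, Real.norm_eq_abs, abs_of_pos (inv_pos.mpr hL), hmesh]
  rw [Finset.mul_sum, Finset.mul_sum]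
  refine Finset.sum_congr rfl fun y _ => ?_
  field_simp

/-- **The block transports across an in-block bond.**  For a bond `b = ⟨x, x + e_μ⟩` inside one `(k+1)`-block (block point
`y`) and a `δ`-regular `A` (`k < K`, at least two `(k+1)`-sites per direction),
`‖U(A(Γ_{y,x+e_μ}))ψ(x + e_μ) − U(A(Γ_{y,x}))ψ(x)‖ ≤ Lᵏε·‖(D_{Ā^{(k)}}ψ)(b)‖ + 2dL·L^{2k}·ε|e|δ·‖ψ(x + e_μ)‖`: the transports
along `Γ_{y,x} ∪ b` and `Γ_{y,x+e_μ}` differ by `U` of the one-step holonomy (`abs_hol_block_le`, `‖U(a)w − w‖ ≤ |εea|‖w‖`), and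
`U` along the straight bond is the coarse transport `U_{Lᵏε}(Ā^{(k)}_b)` of (II.2.55) (`B2Ineq329CovariantAveraging.U_mesh_barA`),
whence the covariant derivative (1.7) of `ψ` in the averaged field («gauge away the constant field», p. 593).
[cite: Balaban1983RegularityDecay, §5 (5.2)–(5.3) p.593] [cite: Balaban1982Higgs1, (1.7) p.605, (2.7) p.608] [cite: Balaban1982Higgs2, (2.55) p.570] -/
theorem norm_transport_bond_sub_le (hk : k < P.K) (hN2 : ∀ μ, 2 ≤ P.sitesPerDir (k + 1) μ)
    {A : HiggsLattice.VecField P 0} {δ : ℝ} (hδ : 0 ≤ δ)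
    (hreg : ∀ (z : HiggsLattice.Site P 0) (μ' ν : Fin P.d), |A ⟨z.shift ν, μ'⟩ - A ⟨z, μ'⟩| ≤ δ)
    (ψ : ScalarField P k N) (b : HiggsLattice.PBond P k) (hb : HiggsLattice.blockOf b.tgt = HiggsLattice.blockOf b.src) :
    ‖C.U (P.mesh 0) (contourSum A (toFinest (HiggsLattice.blockOf b.tgt)) (toFinest b.tgt)) (ψ b.tgt)
        - C.U (P.mesh 0) (contourSum A (toFinest (HiggsLattice.blockOf b.src)) (toFinest b.src)) (ψ b.src)‖
      ≤ P.mesh k * ‖covDeriv C (barA k A) ψ b‖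
        + 2 * P.d * P.L * ((P.L : ℝ) ^ k) ^ 2 * (P.mesh 0 * |C.e|) * δ * ‖ψ b.tgt‖ := by
  rw [hb]
  have hm : 0 < P.mesh k := P.mesh_pos k
  have hhol : |contourSum A (toFinest (HiggsLattice.blockOf b.src)) (toFinest b.tgt)
      - contourSum A (toFinest (HiggsLattice.blockOf b.src)) (toFinest b.src) - segSum A (toFinest b.src) b.dir (P.L ^ k)|
      ≤ 2 * P.d * P.L * ((P.L : ℝ) ^ k) ^ 2 * δ := abs_hol_block_le hk hN2 hδ hreg b.src b.dir
  -- the abelian transport algebra: `U(Γ′)w′ − U(Γ)w` against `U(σ)w′ − w`, `σ` the straight bond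
  have key : ∀ (Γ Γ' σ : ℝ) (w w' : EuclideanSpace ℝ (Fin N)),
      ‖C.U (P.mesh 0) Γ' w' - C.U (P.mesh 0) Γ w‖
        ≤ ‖C.U (P.mesh 0) σ w' - w‖ + |P.mesh 0 * C.e * (Γ' - Γ - σ)| * ‖w'‖ := by
    intro Γ Γ' σ w w'
    have e1 : ‖C.U (P.mesh 0) Γ' w' - C.U (P.mesh 0) Γ w‖ = ‖C.U (P.mesh 0) (Γ' - Γ) w' - w‖ := by
      rw [← norm_U_apply C (P.mesh 0) (-Γ) (C.U (P.mesh 0) Γ' w' - C.U (P.mesh 0) Γ w), map_sub, U_apply_U, U_apply_U,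
        neg_add_cancel, C.U_zero, one_apply_eq_self, neg_add_eq_sub]
    have e2 : C.U (P.mesh 0) (Γ' - Γ) w' - w
        = (C.U (P.mesh 0) σ w' - w) + C.U (P.mesh 0) σ (C.U (P.mesh 0) (Γ' - Γ - σ) w' - w') := by
      rw [map_sub, U_apply_U, show σ + (Γ' - Γ - σ) = Γ' - Γ by ring]
      abel
    rw [e1, e2]
    refine (norm_add_le _ _).trans (add_le_add le_rfl ?_)
    rw [norm_U_apply]
    exact norm_U_apply_sub_le C (P.mesh 0) _ w'
  refine (key _ _ (segSum A (toFinest b.src) b.dir (P.L ^ k)) _ _).trans (add_le_add ?_ ?_)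
  · -- the straight bond: `U_ε(σ) = U_{Lᵏε}(Ā_b)` and the covariant derivative (1.7)
    rw [← U_mesh_barA C A b]
    have e3 : C.U (P.mesh k) (barA k A b) (ψ b.tgt) - ψ b.src = P.mesh k • covDeriv C (barA k A) ψ b := by
      rw [covDeriv, smul_smul, mul_inv_cancel₀ hm.ne', one_smul]
    rw [e3, norm_smul, Real.norm_eq_abs, abs_of_pos hm]
  · -- the holonomy defect
    rw [abs_mul, abs_mul, abs_of_pos (P.mesh_pos 0)]
    have h00 : 0 ≤ P.mesh 0 * |C.e| := mul_nonneg (P.mesh_pos 0).le (abs_nonneg _)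
    exact (mul_le_mul_of_nonneg_right (mul_le_mul_of_nonneg_left hhol h00) (norm_nonneg _)).trans_eq (by ring)

/-- **THE COVARIANT BLOCK POINCARÉ INEQUALITY at level `k`** (`k < K`, at least two `(k+1)`-sites per direction, `A`
`δ`-regular on `T_ε`): for every field `ψ` on `T^{(k)}`,
`‖ψ‖² ≤ ⟨ψ, P(A)ψ⟩ + (L²/4)(Lᵏε)²⟨D_{Ā^{(k)}}ψ, D_{Ā^{(k)}}ψ⟩ + (L²/4)·d·θ²‖ψ‖²`, `θ = 2dL·L^{2k}·ε|e|·δ` ((1.5)-norms; `P(A)`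
the block projection of (2.30), `Ā^{(k)}` the averaged field (II.2.55)).  The [B4] §4 mechanism behind the `P(A)`-term of
(2.33): in the gauge `ψ′(x) = U(A(Γ_{y,x}))ψ(x)` of each block the block means are `Q(A)ψ` (`siteInner_blockProjA_transport`),
the in-block differences of `ψ′` are covariant derivatives up to the one-step holonomy (`norm_transport_bond_sub_le`), and the
scalar block Poincaré inequality (`B1Ineq233LowerZeroField.block_poincare_vec`, constant `L²/8`) is summed over the blocks —
the printed «separate the blocks …, gauge away the constant field, … Laplace operator with Neumann boundary conditions for each
block plus the projection operator on constant functions … bounded from below» of (5.2)–(5.3), with the expansion in `A′`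
replaced by the exact holonomy bound.  At `A = 0` (`δ = 0`) this is `B1Ineq233LowerZeroField.siteInner_self_le_blockProjA_add`
with `L²/8 ↦ L²/4`. [cite: Balaban1983RegularityDecay, §5 (5.2)–(5.3) p.593, (2.27) p.580] [cite: Balaban1982Higgs1, Prop. 2.3 (2.33) p.611] -/
theorem siteInner_self_le_blockProjA_add_cov (hk : k < P.K) (hN2 : ∀ μ, 2 ≤ P.sitesPerDir (k + 1) μ)
    (A : HiggsLattice.VecField P 0) {δ : ℝ} (hδ : 0 ≤ δ)
    (hreg : ∀ (z : HiggsLattice.Site P 0) (μ' ν : Fin P.d), |A ⟨z.shift ν, μ'⟩ - A ⟨z, μ'⟩| ≤ δ)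
    (ψ : ScalarField P k N) :
    siteInner ψ ψ ≤ siteInner ψ (blockProjA C A k ψ)
      + (P.L : ℝ) ^ 2 / 4 * P.mesh k ^ 2 * bondInner (covDeriv C (barA k A) ψ) (covDeriv C (barA k A) ψ)
      + (P.L : ℝ) ^ 2 / 4 * P.d * (2 * P.d * P.L * ((P.L : ℝ) ^ k) ^ 2 * (P.mesh 0 * |C.e|) * δ) ^ 2 * siteInner ψ ψ := by
  classical
  obtain ⟨θ, hθ⟩ : ∃ θ : ℝ, θ = 2 * P.d * P.L * ((P.L : ℝ) ^ k) ^ 2 * (P.mesh 0 * |C.e|) * δ := ⟨_, rfl⟩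
  rw [← hθ]
  obtain ⟨ψ', hψ'⟩ : ∃ ψ' : ScalarField P k N,
      ψ' = fun x => C.U (P.mesh 0) (contourSum A (toFinest (HiggsLattice.blockOf x)) (toFinest x)) (ψ x) := ⟨_, rfl⟩
  have hm : 0 < P.mesh k := P.mesh_pos k
  have hmd : 0 < P.mesh k ^ P.d := pow_pos hm _
  have hnorm : ∀ x, ‖ψ' x‖ = ‖ψ x‖ := fun x => by rw [hψ']; exact norm_U_apply C _ _ _
  -- per in-block bond: `‖ψ′(b₊) − ψ′(b₋)‖² ≤ 2(Lᵏε)²‖(Dψ)(b)‖² + 2θ²‖ψ(b₊)‖²`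
  have hbond : ∀ b : HiggsLattice.PBond P k, HiggsLattice.blockOf b.tgt = HiggsLattice.blockOf b.src →
      ‖ψ' b.tgt - ψ' b.src‖ ^ 2
        ≤ 2 * (P.mesh k ^ 2 * ‖covDeriv C (barA k A) ψ b‖ ^ 2) + 2 * (θ ^ 2 * ‖ψ b.tgt‖ ^ 2) := by
    intro b hb
    have h := norm_transport_bond_sub_le C hk hN2 hδ hreg ψ b hb
    rw [← hθ] at h
    have h' : ‖ψ' b.tgt - ψ' b.src‖ ≤ P.mesh k * ‖covDeriv C (barA k A) ψ b‖ + θ * ‖ψ b.tgt‖ := by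
      rw [hψ']; exact h
    have h0 : 0 ≤ ‖ψ' b.tgt - ψ' b.src‖ := norm_nonneg _
    have hsq : ‖ψ' b.tgt - ψ' b.src‖ ^ 2
        ≤ 2 * (P.mesh k * ‖covDeriv C (barA k A) ψ b‖) ^ 2 + 2 * (θ * ‖ψ b.tgt‖) ^ 2 := by
      nlinarith [mul_nonneg h0 (sub_nonneg.mpr h'), mul_nonneg (h0.trans h') (sub_nonneg.mpr h'),
        sq_nonneg (P.mesh k * ‖covDeriv C (barA k A) ψ b‖ - θ * ‖ψ b.tgt‖)]
    rw [mul_pow, mul_pow] at hsq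
    exact hsq
  -- (1) `‖ψ‖²` block by block
  have h1 : siteInner ψ ψ = P.mesh k ^ P.d * ∑ y : HiggsLattice.Site P (k + 1), ∑ x ∈ HiggsLattice.block y, ‖ψ x‖ ^ 2 := by
    rw [siteInner, ← Finset.mul_sum]
    congr 1
    simp_rw [real_inner_self_eq_norm_sq]
    exact (Finset.sum_fiberwise_of_maps_to (s := Finset.univ) (t := Finset.univ)
      (g := fun x : HiggsLattice.Site P k => HiggsLattice.blockOf x) (fun _ _ => Finset.mem_univ _) _).symm
  -- (2) `⟨ψ, P(A)ψ⟩`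
  have h2 : siteInner ψ (blockProjA C A k ψ) = P.mesh k ^ P.d * (((P.L : ℝ) ^ P.d)⁻¹ *
      ∑ y : HiggsLattice.Site P (k + 1), ‖∑ x ∈ HiggsLattice.block y, ψ' x‖ ^ 2) := by
    rw [hψ']; exact siteInner_blockProjA_transport C A ψ
  -- (3) the bond form
  have h3 : bondInner (covDeriv C (barA k A) ψ) (covDeriv C (barA k A) ψ)
      = P.mesh k ^ P.d * ∑ b : HiggsLattice.PBond P k, ‖covDeriv C (barA k A) ψ b‖ ^ 2 := by
    rw [bondInner, Finset.mul_sum]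
    refine Finset.sum_congr rfl fun b _ => ?_
    rw [real_inner_self_eq_norm_sq]
  -- (4) the in-block bond sums
  have h4 : ∑ y : HiggsLattice.Site P (k + 1), ∑ b : HiggsLattice.PBond P k,
      (if Inside (HiggsLattice.block y) b then ‖ψ' b.tgt - ψ' b.src‖ ^ 2 else 0)
      ≤ (∑ b : HiggsLattice.PBond P k, 2 * (P.mesh k ^ 2 * ‖covDeriv C (barA k A) ψ b‖ ^ 2))
        + ∑ y : HiggsLattice.Site P (k + 1), ((P.d : ℝ) * ∑ x ∈ HiggsLattice.block y, 2 * (θ ^ 2 * ‖ψ x‖ ^ 2)) := by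
    have hα : ∀ y : HiggsLattice.Site P (k + 1), ∑ b : HiggsLattice.PBond P k,
        (if Inside (HiggsLattice.block y) b then ‖ψ' b.tgt - ψ' b.src‖ ^ 2 else 0)
        ≤ (∑ b : HiggsLattice.PBond P k,
            (if Inside (HiggsLattice.block y) b then 2 * (P.mesh k ^ 2 * ‖covDeriv C (barA k A) ψ b‖ ^ 2) else 0))
          + ∑ b : HiggsLattice.PBond P k,
            (if Inside (HiggsLattice.block y) b then 2 * (θ ^ 2 * ‖ψ b.tgt‖ ^ 2) else 0) := by
      intro y
      rw [← Finset.sum_add_distrib]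
      refine Finset.sum_le_sum fun b _ => ?_
      split_ifs with hin
      · have hs := hin.1
        have ht := hin.2
        simp only [HiggsLattice.block, Finset.mem_filter, Finset.mem_univ, true_and] at hs ht
        exact hbond b (by rw [hs, ht])
      · simp
    have hβ : ∀ y : HiggsLattice.Site P (k + 1), ∑ b : HiggsLattice.PBond P k,
        (if Inside (HiggsLattice.block y) b then 2 * (θ ^ 2 * ‖ψ b.tgt‖ ^ 2) else 0)
        ≤ (P.d : ℝ) * ∑ x ∈ HiggsLattice.block y, 2 * (θ ^ 2 * ‖ψ x‖ ^ 2) := fun y =>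
      sum_inside_tgt_le (HiggsLattice.block y) (fun x => 2 * (θ ^ 2 * ‖ψ x‖ ^ 2)) fun x => by positivity
    have hγ : ∑ y : HiggsLattice.Site P (k + 1), ∑ b : HiggsLattice.PBond P k,
        (if Inside (HiggsLattice.block y) b then 2 * (P.mesh k ^ 2 * ‖covDeriv C (barA k A) ψ b‖ ^ 2) else 0)
        ≤ ∑ b : HiggsLattice.PBond P k, 2 * (P.mesh k ^ 2 * ‖covDeriv C (barA k A) ψ b‖ ^ 2) := by
      rw [Finset.sum_comm]
      exact Finset.sum_le_sum fun b _ => sum_ite_inside_block_le b (by positivity)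
    calc ∑ y : HiggsLattice.Site P (k + 1), ∑ b : HiggsLattice.PBond P k,
          (if Inside (HiggsLattice.block y) b then ‖ψ' b.tgt - ψ' b.src‖ ^ 2 else 0)
        ≤ ∑ y : HiggsLattice.Site P (k + 1), ((∑ b : HiggsLattice.PBond P k,
            (if Inside (HiggsLattice.block y) b then 2 * (P.mesh k ^ 2 * ‖covDeriv C (barA k A) ψ b‖ ^ 2) else 0))
          + (P.d : ℝ) * ∑ x ∈ HiggsLattice.block y, 2 * (θ ^ 2 * ‖ψ x‖ ^ 2)) :=
          Finset.sum_le_sum fun y _ => (hα y).trans (add_le_add le_rfl (hβ y))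
      _ = (∑ y : HiggsLattice.Site P (k + 1), ∑ b : HiggsLattice.PBond P k,
            (if Inside (HiggsLattice.block y) b then 2 * (P.mesh k ^ 2 * ‖covDeriv C (barA k A) ψ b‖ ^ 2) else 0))
          + ∑ y : HiggsLattice.Site P (k + 1), ((P.d : ℝ) * ∑ x ∈ HiggsLattice.block y, 2 * (θ ^ 2 * ‖ψ x‖ ^ 2)) :=
          Finset.sum_add_distrib
      _ ≤ _ := add_le_add hγ le_rfl
  -- constants out of the two sums of (4)
  have hSB : ∑ b : HiggsLattice.PBond P k, 2 * (P.mesh k ^ 2 * ‖covDeriv C (barA k A) ψ b‖ ^ 2)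
      = 2 * P.mesh k ^ 2 * ∑ b : HiggsLattice.PBond P k, ‖covDeriv C (barA k A) ψ b‖ ^ 2 := by
    rw [Finset.mul_sum]
    exact Finset.sum_congr rfl fun b _ => by ring
  have hS1 : ∑ y : HiggsLattice.Site P (k + 1), ((P.d : ℝ) * ∑ x ∈ HiggsLattice.block y, 2 * (θ ^ 2 * ‖ψ x‖ ^ 2))
      = 2 * θ ^ 2 * (P.d : ℝ) * ∑ y : HiggsLattice.Site P (k + 1), ∑ x ∈ HiggsLattice.block y, ‖ψ x‖ ^ 2 := by
    rw [Finset.mul_sum]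
    refine Finset.sum_congr rfl fun y _ => ?_
    rw [Finset.mul_sum, Finset.mul_sum]
    exact Finset.sum_congr rfl fun x _ => by ring
  rw [hSB, hS1] at h4
  -- (5) the block Poincaré inequality for `ψ′`, block by block, summed
  have hblk : ∀ y : HiggsLattice.Site P (k + 1),
      ∑ x ∈ HiggsLattice.block y, ‖ψ x‖ ^ 2 - ((P.L : ℝ) ^ P.d)⁻¹ * ‖∑ x ∈ HiggsLattice.block y, ψ' x‖ ^ 2
        ≤ (P.L : ℝ) ^ 2 / 8 *
          ∑ b : HiggsLattice.PBond P k, if Inside (HiggsLattice.block y) b then ‖ψ' b.tgt - ψ' b.src‖ ^ 2 else 0 := by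
    intro y
    have h := block_poincare_vec hk y ψ'
    simp_rw [hnorm] at h
    exact h
  have hblocks := Finset.sum_le_sum fun y (_ : y ∈ (Finset.univ : Finset (HiggsLattice.Site P (k + 1)))) => hblk y
  rw [Finset.sum_sub_distrib, ← Finset.mul_sum, ← Finset.mul_sum] at hblocks
  -- assemble
  have hL8 : 0 ≤ (P.L : ℝ) ^ 2 / 8 := by positivity
  have h4' := mul_le_mul_of_nonneg_left h4 hL8
  have key : ∑ y : HiggsLattice.Site P (k + 1), ∑ x ∈ HiggsLattice.block y, ‖ψ x‖ ^ 2
      ≤ ((P.L : ℝ) ^ P.d)⁻¹ * ∑ y : HiggsLattice.Site P (k + 1), ‖∑ x ∈ HiggsLattice.block y, ψ' x‖ ^ 2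
        + (P.L : ℝ) ^ 2 / 8 * (2 * P.mesh k ^ 2 * ∑ b : HiggsLattice.PBond P k, ‖covDeriv C (barA k A) ψ b‖ ^ 2
          + 2 * θ ^ 2 * (P.d : ℝ) * ∑ y : HiggsLattice.Site P (k + 1), ∑ x ∈ HiggsLattice.block y, ‖ψ x‖ ^ 2) := by
    linarith
  have eB : (P.L : ℝ) ^ 2 / 4 * P.mesh k ^ 2 * bondInner (covDeriv C (barA k A) ψ) (covDeriv C (barA k A) ψ)
      = (P.L : ℝ) ^ 2 / 4 * P.mesh k ^ 2
        * (P.mesh k ^ P.d * ∑ b : HiggsLattice.PBond P k, ‖covDeriv C (barA k A) ψ b‖ ^ 2) := by rw [h3]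
  have eI : (P.L : ℝ) ^ 2 / 4 * P.d * θ ^ 2 * siteInner ψ ψ = (P.L : ℝ) ^ 2 / 4 * P.d * θ ^ 2
      * (P.mesh k ^ P.d * ∑ y : HiggsLattice.Site P (k + 1), ∑ x ∈ HiggsLattice.block y, ‖ψ x‖ ^ 2) := by rw [h1]
  rw [eB, eI, h2, h1]
  calc P.mesh k ^ P.d * ∑ y : HiggsLattice.Site P (k + 1), ∑ x ∈ HiggsLattice.block y, ‖ψ x‖ ^ 2
      ≤ P.mesh k ^ P.d * (((P.L : ℝ) ^ P.d)⁻¹ * ∑ y : HiggsLattice.Site P (k + 1), ‖∑ x ∈ HiggsLattice.block y, ψ' x‖ ^ 2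
        + (P.L : ℝ) ^ 2 / 8 * (2 * P.mesh k ^ 2 * ∑ b : HiggsLattice.PBond P k, ‖covDeriv C (barA k A) ψ b‖ ^ 2
          + 2 * θ ^ 2 * (P.d : ℝ) * ∑ y : HiggsLattice.Site P (k + 1), ∑ x ∈ HiggsLattice.block y, ‖ψ x‖ ^ 2)) :=
        mul_le_mul_of_nonneg_left key hmd.le
    _ = _ := by ring

end CovPoincare

/-! ## §4 (2.33) LOWER HALF at a regular background on the whole torus, `1 ≤ k < K` -/

section Lower

open B2Eq337ScalarIntegration (Regions V)
open B2Eq328ConcretePieces (LSite pieceF)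
open B2Eq328DeltaK (extL)
open B2Prop31ZeroFieldConcrete (massK)
open B2Ineq329RegularField (ineq329_regular_deltaKA gamma0_regular_spec)
open B1Ineq233LowerZeroFieldTorus (pieceF_eq_univ inside_of_univ extL_comp_val massK_comp_val bondInner_self_nonneg)

variable (C : ChargeData N) {a msq : ℝ}

/-- **(II.3.29) = [B4] (1.22) AT A REGULAR `Ã` ON THE WHOLE TORUS, concrete carrier** (`k = j+1 ≤ K`, `Lᵏε ≤ 1`, `Ã` `δ`-regular on
`T_ε`, `8d⁴L^d e²(Lᵏε)²(Lᵏδ)² ≤ ½`; `γ₀ ≥ 0` with `γ₀(8d + 2m² + 4) ≤ a(1 − L⁻²)`, `γ₀ ≤ 1/16`): for EVERY `ψ : T^{(k)} → ℝ^N`,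
`γ₀(⟨D_{Ā^{(k)}}ψ, D_{Ā^{(k)}}ψ⟩ + m²‖ψ‖²) − 64γ₀d³e²(Lᵏδ)²‖ψ‖² ≤ ⟨ψ, Δ^{(k),Lᵏε}(T_ε, Ã)ψ⟩` — p23's `ineq329_regular_deltaKA` on the
trivial regions `Λ_k = T^{(k)}` (transport as in `B1Ineq233LowerZeroFieldTorus.delta_lower_zeroField`).
[cite: Balaban1982Higgs2, (3.29) p.590] [cite: Balaban1983RegularityDecay, (1.21)–(1.22) p.574] -/
theorem delta_lower_regular (ha : 0 < a) (hL : 1 < P.L) (hmsq : 0 < msq) {j : ℕ} (hjK : j + 1 ≤ P.K)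
    (hs : P.mesh (j + 1) ≤ 1) (A : HiggsLattice.VecField P 0) {δ : ℝ} (hδ : 0 ≤ δ)
    (hreg : ∀ (z : HiggsLattice.Site P 0) (μ' ν : Fin P.d), |A ⟨z.shift ν, μ'⟩ - A ⟨z, μ'⟩| ≤ δ)
    (hsmall : 8 * (P.d : ℝ) ^ 4 * (P.L : ℝ) ^ P.d * C.e ^ 2 * P.mesh (j + 1) ^ 2 *
      ((P.L : ℝ) ^ (j + 1)) ^ 2 * δ ^ 2 ≤ 1 / 2)
    {γ₀ : ℝ} (hγ0 : 0 ≤ γ₀) (hγB : γ₀ * (8 * P.d + 2 * msq + 4) ≤ a * (1 - ((P.L : ℝ) ^ 2)⁻¹))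
    (hγ16 : γ₀ ≤ 1 / 16) (ψ : ScalarField P (j + 1) N) :
    γ₀ * (bondInner (covDeriv C (barA (j + 1) A) ψ) (covDeriv C (barA (j + 1) A) ψ) + msq * siteInner ψ ψ)
      - 64 * γ₀ * (P.d : ℝ) ^ 3 * C.e ^ 2 * ((P.L : ℝ) ^ (j + 1)) ^ 2 * δ ^ 2 * siteInner ψ ψ
      ≤ siteInner ψ (deltaKA C Finset.univ A msq a (j + 1) ψ) := by
  set R : Regions P (j + 1) := ⟨∅, fun _ => Finset.univ⟩ with hRdef
  have hR : R.block (Fin.last j) = Finset.univ := rfl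
  set ψ' : LSite R (Fin.last j) → V N := fun y => ψ y.1 with hψ'
  have hreg' : ∀ z ∈ pieceF R (Fin.last j), ∀ μ' ν : Fin P.d, |A ⟨z.shift ν, μ'⟩ - A ⟨z, μ'⟩| ≤ δ :=
    fun z _ μ' ν => hreg z μ' ν
  have h := ineq329_regular_deltaKA R C hjK ha hL hmsq A (Fin.last j) hs hδ hreg' hsmall hγ0 hγB hγ16 ψ'
  have e3 : extL R (Fin.last j) ψ' = ψ := extL_comp_val R _ hR ψ
  have e4 : pieceF R (Fin.last j) = Finset.univ := pieceF_eq_univ R _ hR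
  have e2 : massK R msq (Fin.last j) ψ' = msq * siteInner ψ ψ := massK_comp_val R _ hR msq ψ
  have e5 : (∑ y : LSite R (Fin.last j), P.mesh ((Fin.last j).val + 1) ^ P.d * ‖ψ' y‖ ^ 2) = siteInner ψ ψ := by
    have h1 := massK_comp_val R (Fin.last j) hR 1 ψ
    rw [one_mul, massK] at h1
    refine Eq.trans ?_ h1
    exact Finset.sum_congr rfl fun y _ => by simp only [hψ', mul_one]
  rw [e3, e4, e2, e5] at h
  have e1 : (∑ c : HiggsLattice.PBond P ((Fin.last j).val + 1), if Inside (R.block (Fin.last j)) c then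
      P.mesh ((Fin.last j).val + 1) ^ P.d * ‖covDeriv C (barA ((Fin.last j).val + 1) A) ψ c‖ ^ 2 else 0)
      = bondInner (covDeriv C (barA (j + 1) A) ψ) (covDeriv C (barA (j + 1) A) ψ) := by
    rw [bondInner]
    refine Finset.sum_congr rfl fun c _ => ?_
    rw [if_pos (inside_of_univ R _ hR c), real_inner_self_eq_norm_sq]
    rfl
  rw [e1] at h
  exact h

/-- **(2.33) LOWER HALF AT A REGULAR BACKGROUND `Ã ≠ 0` ON THE WHOLE TORUS, `1 ≤ k < K`, concrete carrier**: for `m² > 0`,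
`a > 0`, `L > 1`, `k = j+1 < K`, at least two `(k+1)`-sites per direction, `Lᵏε ≤ 1`, `Ã` `δ`-regular on `T_ε` with the
three smallness conditions `8d⁴L^d e²(Lᵏε)²(Lᵏδ)² ≤ ½` (p23's), `64γ₀d³e²(Lᵏδ)²(Lᵏε)² ≤ c₁/4` and `L²d·θ² ≤ 1`
(`θ = 2dL·L^{2k}ε|e|δ`, `c₁ = min{a, 4γ₀}/L²`), and `γ₀` as in p23's (3.29) (`γ₀(8d + 2m² + 4) ≤ a(1 − L⁻²)`, `γ₀ ≤ 1/16`):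
for EVERY `ψ : T^{(k)} → ℝ^N`, `(c₁/2)(Lᵏε)^{−2}‖ψ‖² ≤ ⟨ψ, (a(L^{k+1}ε)^{−2}P(Ã) + Δ^{(k),Lᵏε}(T_ε, Ã))ψ⟩` — the printed
`γ₀I ≤ aL^{−2}P(A) + Δ^{(k)}(Ω, A)` for `Ω = T_ε` at a regular `A ≠ 0`, unit-lattice constant `c₁/2`, uniform in `k`, the volume
and `ε`.  Assembly: the covariant block Poincaré inequality (§3) bounds `‖ψ‖²` by `⟨ψ,P(Ã)ψ⟩`, the covariant bond form and
`θ²‖ψ‖²`; (II.3.29) at the regular field (§4) bounds the bond form by `⟨ψ, Δ^{(k)}ψ⟩` plus `(Lᵏδ)²‖ψ‖²`; the two error terms are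
absorbed by the smallness conditions («for e sufficiently small and we get the lower bound», (5.3)).
[cite: Balaban1982Higgs1, Prop. 2.3 (2.33) p.611] [cite: Balaban1983RegularityDecay, §5 (5.2)–(5.3) p.593, (1.21)–(1.22) p.574] -/
theorem ineq233_lower_regular_torus (ha : 0 < a) (hL : 1 < P.L) (hmsq : 0 < msq) {j : ℕ} (hjK : j + 1 < P.K)
    (hN2 : ∀ μ, 2 ≤ P.sitesPerDir (j + 1 + 1) μ) (hs : P.mesh (j + 1) ≤ 1)
    (A : HiggsLattice.VecField P 0) {δ : ℝ} (hδ : 0 ≤ δ)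
    (hreg : ∀ (z : HiggsLattice.Site P 0) (μ' ν : Fin P.d), |A ⟨z.shift ν, μ'⟩ - A ⟨z, μ'⟩| ≤ δ)
    (hsmall : 8 * (P.d : ℝ) ^ 4 * (P.L : ℝ) ^ P.d * C.e ^ 2 * P.mesh (j + 1) ^ 2 *
      ((P.L : ℝ) ^ (j + 1)) ^ 2 * δ ^ 2 ≤ 1 / 2)
    {γ₀ : ℝ} (hγ0 : 0 ≤ γ₀) (hγB : γ₀ * (8 * P.d + 2 * msq + 4) ≤ a * (1 - ((P.L : ℝ) ^ 2)⁻¹))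
    (hγ16 : γ₀ ≤ 1 / 16)
    (hE : 64 * γ₀ * (P.d : ℝ) ^ 3 * C.e ^ 2 * ((P.L : ℝ) ^ (j + 1)) ^ 2 * δ ^ 2 * P.mesh (j + 1) ^ 2
      ≤ min a (4 * γ₀) / (P.L : ℝ) ^ 2 / 4)
    (hθ : (P.L : ℝ) ^ 2 * P.d * (2 * P.d * P.L * ((P.L : ℝ) ^ (j + 1)) ^ 2 * (P.mesh 0 * |C.e|) * δ) ^ 2 ≤ 1)
    (ψ : ScalarField P (j + 1) N) :
    min a (4 * γ₀) / (P.L : ℝ) ^ 2 / 2 * ((P.mesh (j + 1))⁻¹ ^ 2) * siteInner ψ ψ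
      ≤ siteInner ψ (precOpA C Finset.univ A msq a (j + 1) ψ) := by
  have hL1 : (1 : ℝ) < (P.L : ℝ) := by exact_mod_cast hL
  have hL0 : (0 : ℝ) < (P.L : ℝ) := by linarith
  have hm : 0 < P.mesh (j + 1) := P.mesh_pos (j + 1)
  obtain ⟨S, hS⟩ : ∃ S, S = siteInner ψ ψ := ⟨_, rfl⟩
  obtain ⟨X, hX⟩ : ∃ X, X = siteInner ψ (blockProjA C A (j + 1) ψ) := ⟨_, rfl⟩
  obtain ⟨B, hB⟩ : ∃ B, B = bondInner (covDeriv C (barA (j + 1) A) ψ) (covDeriv C (barA (j + 1) A) ψ) := ⟨_, rfl⟩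
  obtain ⟨D, hD⟩ : ∃ D, D = siteInner ψ (deltaKA C Finset.univ A msq a (j + 1) ψ) := ⟨_, rfl⟩
  obtain ⟨θ, hθdef⟩ : ∃ θ : ℝ, θ = 2 * P.d * P.L * ((P.L : ℝ) ^ (j + 1)) ^ 2 * (P.mesh 0 * |C.e|) * δ := ⟨_, rfl⟩
  obtain ⟨E, hEdef⟩ : ∃ E : ℝ, E = 64 * γ₀ * (P.d : ℝ) ^ 3 * C.e ^ 2 * ((P.L : ℝ) ^ (j + 1)) ^ 2 * δ ^ 2 := ⟨_, rfl⟩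
  obtain ⟨c₁, hc₁⟩ : ∃ c₁ : ℝ, c₁ = min a (4 * γ₀) / (P.L : ℝ) ^ 2 := ⟨_, rfl⟩
  rw [← hθdef] at hθ
  rw [← hEdef, ← hc₁] at hE
  have hS0 : 0 ≤ S := hS ▸ siteInner_self_nonneg ψ
  have hX0 : 0 ≤ X := by rw [hX, siteInner_blockProjA_eq]; exact siteInner_self_nonneg _
  have hB0 : 0 ≤ B := hB ▸ bondInner_self_nonneg _
  have hmi0 : 0 < (P.mesh (j + 1))⁻¹ ^ 2 := by positivity
  -- the covariant block Poincaré inequality (§3)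
  have hCP : S ≤ X + (P.L : ℝ) ^ 2 / 4 * P.mesh (j + 1) ^ 2 * B + (P.L : ℝ) ^ 2 / 4 * P.d * θ ^ 2 * S := by
    rw [hS, hX, hB, hθdef]; exact siteInner_self_le_blockProjA_add_cov C hjK hN2 A hδ hreg ψ
  -- (II.3.29) at the regular field on the torus (§4)
  have hΔ : γ₀ * (B + msq * S) - E * S ≤ D := by
    rw [hB, hS, hEdef, hD]; exact delta_lower_regular C ha hL hmsq hjK.le hs A hδ hreg hsmall hγ0 hγB hγ16 ψ
  -- the form of `a(L^{k+1}ε)^{-2}P(Ã) + Δ^{(k)}(T_ε, Ã)`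
  have hprec : siteInner ψ (precOpA C Finset.univ A msq a (j + 1) ψ) = a * ((P.mesh (j + 1 + 1))⁻¹ ^ 2) * X + D := by
    rw [precOpA, LinearMap.add_apply, LinearMap.smul_apply, siteInner_add_right, siteInner_smul_right, hX, hD]
  have hinv : ((P.L : ℝ) * P.mesh (j + 1))⁻¹ ^ 2 = ((P.L : ℝ) ^ 2)⁻¹ * (P.mesh (j + 1))⁻¹ ^ 2 := by
    rw [mul_inv, mul_pow, inv_pow]
  rw [hprec, ← hS, ← hc₁, mesh_succ (j + 1), hinv]
  -- the constants
  have hc₁0 : 0 ≤ c₁ := by rw [hc₁]; exact div_nonneg (le_min ha.le (by linarith)) (by positivity)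
  have hc₁a : c₁ ≤ a * ((P.L : ℝ) ^ 2)⁻¹ := by
    rw [hc₁, div_eq_mul_inv]
    exact mul_le_mul_of_nonneg_right (min_le_left _ _) (inv_nonneg.mpr (by positivity))
  have hc₁γ : c₁ * ((P.L : ℝ) ^ 2 / 4) ≤ γ₀ := by
    have hL2 : (0 : ℝ) < (P.L : ℝ) ^ 2 := by positivity
    have e : min a (4 * γ₀) / (P.L : ℝ) ^ 2 * ((P.L : ℝ) ^ 2 / 4) = min a (4 * γ₀) / 4 := by
      rw [div_mul_div_comm, mul_comm (min a (4 * γ₀)), mul_div_mul_left _ _ hL2.ne']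
    rw [hc₁, e]
    linarith [min_le_right a (4 * γ₀)]
  -- the pieces, multiplied out
  have hmm : (P.mesh (j + 1))⁻¹ ^ 2 * P.mesh (j + 1) ^ 2 = 1 := by field_simp
  have F1 : c₁ * (P.mesh (j + 1))⁻¹ ^ 2 * S ≤ c₁ * (P.mesh (j + 1))⁻¹ ^ 2 * X + c₁ * ((P.L : ℝ) ^ 2 / 4) * B
      + c₁ * (P.mesh (j + 1))⁻¹ ^ 2 * ((P.L : ℝ) ^ 2 / 4 * P.d * θ ^ 2 * S) := by
    have h := mul_le_mul_of_nonneg_left hCP (mul_nonneg hc₁0 hmi0.le)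
    have e : c₁ * (P.mesh (j + 1))⁻¹ ^ 2 * (X + (P.L : ℝ) ^ 2 / 4 * P.mesh (j + 1) ^ 2 * B
        + (P.L : ℝ) ^ 2 / 4 * P.d * θ ^ 2 * S)
        = c₁ * (P.mesh (j + 1))⁻¹ ^ 2 * X + c₁ * ((P.L : ℝ) ^ 2 / 4) * ((P.mesh (j + 1))⁻¹ ^ 2 * P.mesh (j + 1) ^ 2) * B
          + c₁ * (P.mesh (j + 1))⁻¹ ^ 2 * ((P.L : ℝ) ^ 2 / 4 * P.d * θ ^ 2 * S) := by ring
    rw [hmm, mul_one] at e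
    linarith
  have F2 : c₁ * ((P.mesh (j + 1))⁻¹ ^ 2 * X) ≤ a * ((P.L : ℝ) ^ 2)⁻¹ * ((P.mesh (j + 1))⁻¹ ^ 2 * X) :=
    mul_le_mul_of_nonneg_right hc₁a (mul_nonneg hmi0.le hX0)
  have F3 : c₁ * ((P.L : ℝ) ^ 2 / 4) * B ≤ γ₀ * B := mul_le_mul_of_nonneg_right hc₁γ hB0
  have F5 : 0 ≤ γ₀ * msq * S := mul_nonneg (mul_nonneg hγ0 hmsq.le) hS0
  -- the two error terms against `(c₁/2)(Lᵏε)^{-2}‖ψ‖²`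
  have F6 : E * S + c₁ * (P.mesh (j + 1))⁻¹ ^ 2 * ((P.L : ℝ) ^ 2 / 4 * P.d * θ ^ 2 * S)
      ≤ c₁ / 2 * (P.mesh (j + 1))⁻¹ ^ 2 * S := by
    have h1 : E ≤ c₁ / 4 * (P.mesh (j + 1))⁻¹ ^ 2 := by
      have e : E * P.mesh (j + 1) ^ 2 * (P.mesh (j + 1))⁻¹ ^ 2 = E := by field_simp
      calc E = E * P.mesh (j + 1) ^ 2 * (P.mesh (j + 1))⁻¹ ^ 2 := e.symm
        _ ≤ c₁ / 4 * (P.mesh (j + 1))⁻¹ ^ 2 := mul_le_mul_of_nonneg_right hE hmi0.le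
    have h2 : (P.L : ℝ) ^ 2 / 4 * P.d * θ ^ 2 ≤ 1 / 4 := by linarith
    have h3 : c₁ * (P.mesh (j + 1))⁻¹ ^ 2 * ((P.L : ℝ) ^ 2 / 4 * P.d * θ ^ 2 * S)
        ≤ c₁ * (P.mesh (j + 1))⁻¹ ^ 2 * (1 / 4 * S) :=
      mul_le_mul_of_nonneg_left (mul_le_mul_of_nonneg_right h2 hS0) (mul_nonneg hc₁0 hmi0.le)
    have h4 : E * S ≤ c₁ / 4 * (P.mesh (j + 1))⁻¹ ^ 2 * S := mul_le_mul_of_nonneg_right h1 hS0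
    linarith
  linarith

end Lower

/-! ## §5 (2.33) LOWER HALF at the background `A^{(k),ε}` of (3.29) on the whole torus -/

section Background

open B3MultiscaleFields (toSite zeroCharge)
open B1Eq31Concrete (bgVec)
open B1Eq211ZeroFieldTorus (Shape)
open B1Ineq225DerivZeroFieldTorus (covDeriv_propagatorK_sup_bound)
open B1Ineq225BackgroundTorus (apply_shift_sub_eq norm_sderiv_bgVec_le)
open B2Ineq329RegularField (gamma0_regular_spec)

/-- Absorption arithmetic: `0 ≤ X`, `0 ≤ t ≤ 1`, `0 ≤ κ`, `t(κX + 1) ≤ c` give `κXt² ≤ c`. [folklore] -/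
private theorem mul_sq_le_of_small {X t c κ : ℝ} (hX : 0 ≤ X) (ht0 : 0 ≤ t) (ht1 : t ≤ 1) (hκ : 0 ≤ κ)
    (h : t * (κ * X + 1) ≤ c) : κ * X * t ^ 2 ≤ c := by
  have htt : t ^ 2 ≤ t := by nlinarith
  nlinarith [mul_nonneg (mul_nonneg hκ hX) (sub_nonneg.mpr htt)]

/-- **THE REGULARITY (2.23) OF THE BACKGROUND `A^{(k),ε}` IN LATTICE UNITS**: `|A^{(k),ε}(b + εe_ν) − A^{(k),ε}(b)| ≤ ε·a c′ r (Lᵏε)^{−1}`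
for `|A| ≤ r`, given the zero-field derivative bound `‖D^ε_0G^ε_k(0)ψ‖_∞ ≤ c′(Lᵏε)‖ψ‖_∞` (p14) — p35's `norm_sderiv_bgVec_le`
read componentwise through (1.4). [cite: Balaban1982Higgs1, (2.23) p.610, (3.29) p.617, (1.4) p.604] -/
theorem abs_bgVec_shift_sub_le {k : ℕ} (hk1 : 1 ≤ k) (hL1 : (1 : ℝ) < P.L) {a mu0sq : ℝ} (ha : 0 < a) {c r : ℝ}
    (hD : ∀ (φ : HiggsLattice.ScalarField P 0 P.d) (M : ℝ), (∀ x, ‖φ x‖ ≤ M) → ∀ b : HiggsLattice.PBond P 0,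
      ‖covDeriv (zeroCharge P.d) (0 : HiggsLattice.VecField P 0)
        (propagatorK (zeroCharge P.d) Finset.univ (0 : HiggsLattice.VecField P 0) mu0sq a k φ) b‖ ≤ c * P.mesh k * M)
    (A : HiggsLattice.VecField P k) (hA : ∀ x, ‖toSite A x‖ ≤ r) (z : HiggsLattice.Site P 0) (μ' ν : Fin P.d) :
    |bgVec mu0sq a k A ⟨z.shift ν, μ'⟩ - bgVec mu0sq a k A ⟨z, μ'⟩| ≤ P.mesh 0 * (a * c * (P.mesh k)⁻¹ * r) := by
  have hmesh0 : 0 < P.mesh 0 := P.mesh_pos 0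
  rw [apply_shift_sub_eq, abs_mul, abs_of_pos hmesh0]
  refine mul_le_mul_of_nonneg_left ?_ hmesh0.le
  calc |(sderiv (toSite (bgVec mu0sq a k A)) ⟨z, ν⟩) μ'|
      = ‖(sderiv (toSite (bgVec mu0sq a k A)) ⟨z, ν⟩) μ'‖ := (Real.norm_eq_abs _).symm
    _ ≤ ‖sderiv (toSite (bgVec mu0sq a k A)) ⟨z, ν⟩‖ := PiLp.norm_apply_le _ μ'
    _ ≤ a * c * (P.mesh k)⁻¹ * r := norm_sderiv_bgVec_le hk1 hL1 ha hD A hA ⟨z, ν⟩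

/-- **(2.33) LOWER HALF AT THE REGULAR BACKGROUND `A^{(k),ε}` OF (3.29), `Ω = T_ε`, EVERY LEVEL `1 ≤ k < K_P`, concrete
(Higgs)₂,₃ carrier.**  For the torus sub-family of `HiggsLattice.Params` with `d`, `L` fixed (`B1Eq211ZeroFieldTorus.Shape`),
`a, μ₀², m² > 0`: there are constants `γ > 0`, `c_A > 0` (depending on `d, L, a, μ₀², m², e` only) such that for every level
`1 ≤ k < K_P` with at least two `(k+1)`-sites per direction, `Lᵏε ≤ 1`, every `A : T^{(k)} → ℝ^d` with `|A| ≤ r`, `r·Lᵏε ≤ c_A`,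
and EVERY `ψ : T^{(k)} → ℝ^N`:  `γ·(Lᵏε)^{−2}‖ψ‖² ≤ ⟨ψ, (a(L^{k+1}ε)^{−2}P(A^{(k),ε}) + Δ^{(k),Lᵏε}(T_ε, A^{(k),ε}))ψ⟩` —
the printed `γ₀I ≤ aL^{−2}P(A) + Δ^{(k)}(Ω,A)` («A regular on Ω in the sense of Proposition 2.1») at the background field
`A^{(k),ε} = a_k(Lᵏε)^{−2}G^ε_k(0)Q_k^*A` of (3.29), whose regularity (2.23) `|∂A^{(k),ε}| ≤ a c′ r (Lᵏε)^{−1}` is p35's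
`B1Ineq225BackgroundTorus.norm_sderiv_bgVec_le` fed with p14's `B1Ineq225DerivZeroFieldTorus.covDeriv_propagatorK_sup_bound`;
`γ = min{a, 4γ₀}/(2L²)` with `γ₀ = min{a(1 − L⁻²)/(8d + 2m² + 4), 1/16}` the constant of (II.3.29) at a regular field, and the
three smallness conditions of `ineq233_lower_regular_torus` all read `O(1)·(a c′·r Lᵏε)² ≤ const`, whence the threshold `c_A`.
[cite: Balaban1982Higgs1, Prop. 2.3 (2.33) p.611; (2.23) p.610; (3.29) p.617] [cite: Balaban1983RegularityDecay, (1.21)–(1.22) p.574] -/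
theorem ineq233_lower_bgVec_torus (d L : ℕ) (hd : 1 ≤ d) (hL : Odd L ∧ 1 < L) {a : ℝ} (ha : 0 < a)
    {mu0sq msq : ℝ} (hmu : 0 < mu0sq) (hmsq : 0 < msq) (N : ℕ) (C : ChargeData N) :
    ∃ γ : ℝ, 0 < γ ∧ ∃ cA : ℝ, 0 < cA ∧
      ∀ (P : HiggsLattice.Params) (_S : Shape P), P.d = d → P.L = L →
      ∀ {k : ℕ}, 1 ≤ k → k < P.K → (∀ μ, 2 ≤ P.sitesPerDir (k + 1) μ) → P.mesh k ≤ 1 →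
      ∀ {r : ℝ}, r * P.mesh k ≤ cA →
      ∀ A : HiggsLattice.VecField P k, (∀ x, ‖toSite A x‖ ≤ r) →
        ∀ ψ : ScalarField P k N,
          γ * ((P.mesh k)⁻¹ ^ 2) * siteInner ψ ψ
            ≤ siteInner ψ (precOpA C Finset.univ (bgVec mu0sq a k A) msq a k ψ) := by
  obtain ⟨c', hc', hder⟩ := covDeriv_propagatorK_sup_bound d L d hd hL ha hmu.le 1
  -- the constants: `γ₀` of (II.3.29) at a regular field, `c₁ = min{a,4γ₀}/L²`, the smallness radius `ρ`, `c_A = ρ/(ac′ + 1)`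
  obtain ⟨γ₀, hγ₀⟩ : ∃ γ₀ : ℝ, γ₀ = min (a * (1 - ((L : ℝ) ^ 2)⁻¹) / (8 * (d : ℝ) + 2 * msq + 4)) (1 / 16) := ⟨_, rfl⟩
  obtain ⟨c₁, hc₁⟩ : ∃ c₁ : ℝ, c₁ = min a (4 * γ₀) / (L : ℝ) ^ 2 := ⟨_, rfl⟩
  obtain ⟨ρ, hρ⟩ : ∃ ρ : ℝ, ρ = min 1 (min (1 / (16 * ((d : ℝ) ^ 4 * (L : ℝ) ^ d * C.e ^ 2) + 1))
      (min (c₁ / (256 * (γ₀ * (d : ℝ) ^ 3 * C.e ^ 2) + 1)) (1 / (4 * ((d : ℝ) ^ 3 * (L : ℝ) ^ 4 * C.e ^ 2) + 1)))) :=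
    ⟨_, rfl⟩
  have hLr : (1 : ℝ) < (L : ℝ) := by exact_mod_cast hL.2
  have hdr : (1 : ℝ) ≤ (d : ℝ) := by exact_mod_cast hd
  have hγ₀pos : 0 < γ₀ := by
    rw [hγ₀]
    refine lt_min (div_pos (mul_pos ha ?_) (by linarith)) (by norm_num)
    have h1 : (1 : ℝ) < (L : ℝ) ^ 2 := by nlinarith
    have : ((L : ℝ) ^ 2)⁻¹ < 1 := inv_lt_one_of_one_lt₀ h1
    linarith
  have hc₁pos : 0 < c₁ := by rw [hc₁]; exact div_pos (lt_min ha (by linarith)) (by positivity)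
  have hX0 : 0 ≤ (d : ℝ) ^ 4 * (L : ℝ) ^ d * C.e ^ 2 := by positivity
  have hY0 : 0 ≤ γ₀ * (d : ℝ) ^ 3 * C.e ^ 2 := mul_nonneg (mul_nonneg hγ₀pos.le (by positivity)) (sq_nonneg _)
  have hZ0 : 0 ≤ (d : ℝ) ^ 3 * (L : ℝ) ^ 4 * C.e ^ 2 := by positivity
  have hρpos : 0 < ρ := by
    rw [hρ]
    exact lt_min one_pos (lt_min (by positivity) (lt_min (div_pos hc₁pos (by positivity)) (by positivity)))
  refine ⟨c₁ / 2, by linarith, ρ / (a * c' + 1), by positivity, ?_⟩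
  intro P S hPd hPL k hk1 hk hN2 hs r hr A hA ψ
  subst hPd hPL
  obtain ⟨j, rfl⟩ : ∃ j, k = j + 1 := ⟨k - 1, by omega⟩
  have hLnat : 1 < P.L := hL.2
  have hmesh : 0 < P.mesh (j + 1) := P.mesh_pos _
  have hmesh0 : 0 < P.mesh 0 := P.mesh_pos 0
  have hmeshK : P.mesh (j + 1) = (P.L : ℝ) ^ (j + 1) * P.mesh 0 := by
    unfold HiggsLattice.Params.mesh; ring
  have hr0 : 0 ≤ r := (norm_nonneg _).trans (hA fun _ => 0)
  -- the regularity of the background: `|Ã(b + εe_ν) − Ã(b)| ≤ δ`, `δ = ε·a c′ r (Lᵏε)^{-1}`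
  obtain ⟨δ, hδdef⟩ : ∃ δ : ℝ, δ = P.mesh 0 * (a * c' * (P.mesh (j + 1))⁻¹ * r) := ⟨_, rfl⟩
  have hδ : 0 ≤ δ := by
    rw [hδdef]
    exact mul_nonneg hmesh0.le (mul_nonneg (mul_nonneg (mul_nonneg ha.le hc'.le) (inv_nonneg.mpr hmesh.le)) hr0)
  have hreg : ∀ (z : HiggsLattice.Site P 0) (μ' ν : Fin P.d),
      |bgVec mu0sq a (j + 1) A ⟨z.shift ν, μ'⟩ - bgVec mu0sq a (j + 1) A ⟨z, μ'⟩| ≤ δ := fun z μ' ν => by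
    rw [hδdef]
    exact abs_bgVec_shift_sub_le hk1 hLr ha
      (fun φ M' hφ b => hder P S rfl rfl (zeroCharge P.d) hk1 hk.le hs φ M' hφ b) A hA z μ' ν
  -- the smallness parameter `t = a c′·(r·Lᵏε) ≤ ρ ≤ 1`
  obtain ⟨t, htdef⟩ : ∃ t : ℝ, t = a * c' * r * P.mesh (j + 1) := ⟨_, rfl⟩
  have ht0 : 0 ≤ t := by rw [htdef]; exact mul_nonneg (mul_nonneg (mul_nonneg ha.le hc'.le) hr0) hmesh.le
  have htρ : t ≤ ρ := by
    have hac : 0 ≤ a * c' := mul_nonneg ha.le hc'.le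
    calc t = a * c' * (r * P.mesh (j + 1)) := by rw [htdef]; ring
      _ ≤ a * c' * (ρ / (a * c' + 1)) := mul_le_mul_of_nonneg_left hr hac
      _ = ρ * (a * c' / (a * c' + 1)) := by ring
      _ ≤ ρ * 1 := mul_le_mul_of_nonneg_left ((div_le_one (by linarith)).mpr (by linarith)) hρpos.le
      _ = ρ := mul_one ρ
  have ht1 : t ≤ 1 := htρ.trans (by rw [hρ]; exact min_le_left _ _)
  -- `Lᵏ·δ·(Lᵏε) = t` and `L^{2k}·ε·δ = t`
  have hkey1 : (P.L : ℝ) ^ (j + 1) * δ * P.mesh (j + 1) = t := by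
    have hmi : (P.mesh (j + 1))⁻¹ * P.mesh (j + 1) = 1 := inv_mul_cancel₀ hmesh.ne'
    calc (P.L : ℝ) ^ (j + 1) * δ * P.mesh (j + 1)
        = ((P.L : ℝ) ^ (j + 1) * P.mesh 0) * (a * c' * r) * ((P.mesh (j + 1))⁻¹ * P.mesh (j + 1)) := by
          rw [hδdef]; ring
      _ = t := by rw [hmi, ← hmeshK, htdef]; ring
  have hkey2 : ((P.L : ℝ) ^ (j + 1)) ^ 2 * P.mesh 0 * δ = t := by
    rw [← hkey1, hmeshK]; ring
  -- the constant `γ₀` of (II.3.29) at a regular field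
  obtain ⟨-, hγB, hγ16⟩ := gamma0_regular_spec (P := P) ha hLnat hmsq.le
  rw [← hγ₀] at hγB hγ16
  -- the three smallness conditions: `O(1)·t² ≤ const` from `t ≤ ρ`
  have hsmall : 8 * (P.d : ℝ) ^ 4 * (P.L : ℝ) ^ P.d * C.e ^ 2 * P.mesh (j + 1) ^ 2 *
      ((P.L : ℝ) ^ (j + 1)) ^ 2 * δ ^ 2 ≤ 1 / 2 := by
    have e : 8 * (P.d : ℝ) ^ 4 * (P.L : ℝ) ^ P.d * C.e ^ 2 * P.mesh (j + 1) ^ 2 * ((P.L : ℝ) ^ (j + 1)) ^ 2 * δ ^ 2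
        = 1 / 2 * (16 * ((P.d : ℝ) ^ 4 * (P.L : ℝ) ^ P.d * C.e ^ 2) * ((P.L : ℝ) ^ (j + 1) * δ * P.mesh (j + 1)) ^ 2) := by
      ring
    rw [e, hkey1]
    have htX : t ≤ 1 / (16 * ((P.d : ℝ) ^ 4 * (P.L : ℝ) ^ P.d * C.e ^ 2) + 1) :=
      htρ.trans (by rw [hρ]; exact (min_le_right _ _).trans (min_le_left _ _))
    rw [le_div_iff₀ (by positivity)] at htX
    linarith [mul_sq_le_of_small hX0 ht0 ht1 (by norm_num) htX]
  have hE : 64 * γ₀ * (P.d : ℝ) ^ 3 * C.e ^ 2 * ((P.L : ℝ) ^ (j + 1)) ^ 2 * δ ^ 2 * P.mesh (j + 1) ^ 2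
      ≤ min a (4 * γ₀) / (P.L : ℝ) ^ 2 / 4 := by
    have e : 64 * γ₀ * (P.d : ℝ) ^ 3 * C.e ^ 2 * ((P.L : ℝ) ^ (j + 1)) ^ 2 * δ ^ 2 * P.mesh (j + 1) ^ 2
        = 1 / 4 * (256 * (γ₀ * (P.d : ℝ) ^ 3 * C.e ^ 2) * ((P.L : ℝ) ^ (j + 1) * δ * P.mesh (j + 1)) ^ 2) := by ring
    rw [e, hkey1, ← hc₁]
    have htY : t ≤ c₁ / (256 * (γ₀ * (P.d : ℝ) ^ 3 * C.e ^ 2) + 1) :=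
      htρ.trans (by rw [hρ]; exact (min_le_right _ _).trans ((min_le_right _ _).trans (min_le_left _ _)))
    rw [le_div_iff₀ (by positivity)] at htY
    linarith [mul_sq_le_of_small hY0 ht0 ht1 (by norm_num) htY]
  have hθ : (P.L : ℝ) ^ 2 * P.d * (2 * P.d * P.L * ((P.L : ℝ) ^ (j + 1)) ^ 2 * (P.mesh 0 * |C.e|) * δ) ^ 2 ≤ 1 := by
    have e : (P.L : ℝ) ^ 2 * P.d * (2 * P.d * P.L * ((P.L : ℝ) ^ (j + 1)) ^ 2 * (P.mesh 0 * |C.e|) * δ) ^ 2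
        = 4 * ((P.d : ℝ) ^ 3 * (P.L : ℝ) ^ 4 * C.e ^ 2) * (((P.L : ℝ) ^ (j + 1)) ^ 2 * P.mesh 0 * δ) ^ 2 := by
      rw [← sq_abs C.e]; ring
    rw [e, hkey2]
    have htZ : t ≤ 1 / (4 * ((P.d : ℝ) ^ 3 * (P.L : ℝ) ^ 4 * C.e ^ 2) + 1) :=
      htρ.trans (by rw [hρ]; exact (min_le_right _ _).trans ((min_le_right _ _).trans (min_le_right _ _)))
    rw [le_div_iff₀ (by positivity)] at htZ
    exact mul_sq_le_of_small hZ0 ht0 ht1 (by norm_num) htZ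
  have hmain := ineq233_lower_regular_torus C ha hLnat hmsq hk hN2 hs (bgVec mu0sq a (j + 1) A) hδ hreg hsmall
    hγ₀pos.le hγB hγ16 hE hθ ψ
  rw [← hc₁] at hmain
  exact hmain

end Background

/-! ## §6 (v1.1) Level `k = 0`: (2.33) LOWER HALF at a regular `A` for `a(Lε)^{−2}P(A) + (−Δ_A + m²)` on `T_ε` -/

section LevelZero

open B2Eq255Concrete (barA_zero_level)

variable (C : ChargeData N) {a msq : ℝ}

/-- **Level `0`**: `⟨ψ, Δ^{(0),ε}(T_ε, A)ψ⟩ = ⟨D_Aψ, D_Aψ⟩ + m²‖ψ‖²` ((2.17): `Δ^{(0),ε}(Ω, A) = −Δ^{ε,N}_{A,Ω} + m²`, the typer's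
`delta0`, summed by parts on the whole torus by `HiggsCovariancePos.siteInner_covLaplacianN_univ`) — the (II.3.29) shape at level
`0` with `γ₀ = 1` for EVERY `A`, no regularity needed. [cite: Balaban1982Higgs1, (2.17) p.610] -/
theorem siteInner_deltaKA_levelZero_cov (A : HiggsLattice.VecField P 0) (msq a : ℝ) (ψ : ScalarField P 0 N) :
    siteInner ψ (deltaKA C Finset.univ A msq a 0 ψ)
      = bondInner (covDeriv C A ψ) (covDeriv C A ψ) + msq * siteInner ψ ψ := by
  simp only [deltaKA_zero, delta0, LinearMap.add_apply, LinearMap.smul_apply, LinearMap.id_apply,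
    siteInner_add_right, siteInner_smul_right]
  rw [siteInner_covLaplacianN_univ]

/-- **(2.33) LOWER HALF AT LEVEL `0` FOR A REGULAR `A ≠ 0` ON THE WHOLE TORUS** (`a, m² ≥ 0`, `0 < K`, `A` `δ`-regular on `T_ε`
with the single smallness condition `L²d·θ₀² ≤ 1`, `θ₀ = 2dL·ε|e|·δ`; at least two level-`1` sites per direction): for EVERY
`ψ : T_ε → ℝ^N`, `(3c₁⁰/4)·ε^{−2}‖ψ‖² ≤ ⟨ψ, (a(Lε)^{−2}P(A) + (−Δ^ε_A + m²))ψ⟩`, `c₁⁰ = min{a, 4}/L²` — the [B4] (5.2)–(5.3)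
assembly at level `0`, where Proposition II.3.1′ is replaced by the identity `siteInner_deltaKA_levelZero_cov` (the operator
(2.17) IS the covariant Dirichlet form plus the mass), so no `(L^kδ)²`-error and no `L^kε ≤ 1` are needed; the `P(A)`-term is the
covariant block Poincaré inequality of §3 at `k = 0` (`Ā^{(0)} = A`, `B2Eq255Concrete.barA_zero_level`).  With §4 this gives the
regular-background lower half of (2.33) at every level `0 ≤ k < K`. [cite: Balaban1982Higgs1, Prop. 2.3 (2.33) p.611, (2.17) p.610]
[cite: Balaban1983RegularityDecay, §5 (5.2)–(5.3) p.593] -/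
theorem ineq233_lower_regular_torus_levelZero (ha : 0 ≤ a) (hmsq : 0 ≤ msq) (hK : 0 < P.K)
    (hN2 : ∀ μ, 2 ≤ P.sitesPerDir 1 μ) (A : HiggsLattice.VecField P 0) {δ : ℝ} (hδ : 0 ≤ δ)
    (hreg : ∀ (z : HiggsLattice.Site P 0) (μ' ν : Fin P.d), |A ⟨z.shift ν, μ'⟩ - A ⟨z, μ'⟩| ≤ δ)
    (hθ : (P.L : ℝ) ^ 2 * P.d * (2 * P.d * P.L * (P.mesh 0 * |C.e|) * δ) ^ 2 ≤ 1)
    (ψ : ScalarField P 0 N) :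
    3 * (min a 4 / (P.L : ℝ) ^ 2) / 4 * ((P.mesh 0)⁻¹ ^ 2) * siteInner ψ ψ
      ≤ siteInner ψ (precOpA C Finset.univ A msq a 0 ψ) := by
  have hL1 : (1 : ℝ) ≤ (P.L : ℝ) := by exact_mod_cast P.hL
  have hL0 : (0 : ℝ) < (P.L : ℝ) := by linarith
  have hm : 0 < P.mesh 0 := P.mesh_pos 0
  obtain ⟨S, hS⟩ : ∃ S, S = siteInner ψ ψ := ⟨_, rfl⟩
  obtain ⟨X, hX⟩ : ∃ X, X = siteInner ψ (blockProjA C A 0 ψ) := ⟨_, rfl⟩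
  obtain ⟨B, hB⟩ : ∃ B, B = bondInner (covDeriv C A ψ) (covDeriv C A ψ) := ⟨_, rfl⟩
  obtain ⟨D, hD⟩ : ∃ D, D = siteInner ψ (deltaKA C Finset.univ A msq a 0 ψ) := ⟨_, rfl⟩
  obtain ⟨θ, hθdef⟩ : ∃ θ : ℝ, θ = 2 * P.d * P.L * (P.mesh 0 * |C.e|) * δ := ⟨_, rfl⟩
  obtain ⟨c₁, hc₁⟩ : ∃ c₁ : ℝ, c₁ = min a 4 / (P.L : ℝ) ^ 2 := ⟨_, rfl⟩
  rw [← hθdef] at hθ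
  have hS0 : 0 ≤ S := hS ▸ siteInner_self_nonneg ψ
  have hX0 : 0 ≤ X := by rw [hX, siteInner_blockProjA_eq]; exact siteInner_self_nonneg _
  have hB0 : 0 ≤ B := hB ▸ B1Ineq233LowerZeroFieldTorus.bondInner_self_nonneg _
  have hmi0 : 0 < (P.mesh 0)⁻¹ ^ 2 := by positivity
  -- the covariant block Poincaré inequality (§3) at level 0, `Ā^{(0)} = A`, `(L^0)^2 = 1`
  have hCP : S ≤ X + (P.L : ℝ) ^ 2 / 4 * P.mesh 0 ^ 2 * B + (P.L : ℝ) ^ 2 / 4 * P.d * θ ^ 2 * S := by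
    have h := siteInner_self_le_blockProjA_add_cov C hK hN2 A hδ hreg ψ
    rw [barA_zero_level, pow_zero, one_pow, mul_one] at h
    rw [hS, hX, hB, hθdef]; exact h
  -- (2.17): the level-0 operator is the covariant Dirichlet form plus the mass
  have hΔ : B + msq * S = D := by rw [hB, hS, hD, siteInner_deltaKA_levelZero_cov]
  have hprec : siteInner ψ (precOpA C Finset.univ A msq a 0 ψ) = a * ((P.mesh (0 + 1))⁻¹ ^ 2) * X + D := by
    rw [precOpA, LinearMap.add_apply, LinearMap.smul_apply, siteInner_add_right, siteInner_smul_right, hX, hD]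
  have hinv : ((P.L : ℝ) * P.mesh 0)⁻¹ ^ 2 = ((P.L : ℝ) ^ 2)⁻¹ * (P.mesh 0)⁻¹ ^ 2 := by
    rw [mul_inv, mul_pow, inv_pow]
  rw [hprec, ← hS, ← hc₁, mesh_succ 0, hinv]
  -- the constants
  have hc₁0 : 0 ≤ c₁ := by rw [hc₁]; exact div_nonneg (le_min ha (by norm_num)) (by positivity)
  have hc₁a : c₁ ≤ a * ((P.L : ℝ) ^ 2)⁻¹ := by
    rw [hc₁, div_eq_mul_inv]
    exact mul_le_mul_of_nonneg_right (min_le_left _ _) (inv_nonneg.mpr (by positivity))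
  have hc₁γ : c₁ * ((P.L : ℝ) ^ 2 / 4) ≤ 1 := by
    have hL2 : (0 : ℝ) < (P.L : ℝ) ^ 2 := by positivity
    have e : min a 4 / (P.L : ℝ) ^ 2 * ((P.L : ℝ) ^ 2 / 4) = min a 4 / 4 := by
      rw [div_mul_div_comm, mul_comm (min a 4), mul_div_mul_left _ _ hL2.ne']
    rw [hc₁, e]
    linarith [min_le_right a 4]
  -- the pieces, multiplied out
  have hmm : (P.mesh 0)⁻¹ ^ 2 * P.mesh 0 ^ 2 = 1 := by field_simp
  have F1 : c₁ * (P.mesh 0)⁻¹ ^ 2 * S ≤ c₁ * (P.mesh 0)⁻¹ ^ 2 * X + c₁ * ((P.L : ℝ) ^ 2 / 4) * B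
      + c₁ * (P.mesh 0)⁻¹ ^ 2 * ((P.L : ℝ) ^ 2 / 4 * P.d * θ ^ 2 * S) := by
    have h := mul_le_mul_of_nonneg_left hCP (mul_nonneg hc₁0 hmi0.le)
    have e : c₁ * (P.mesh 0)⁻¹ ^ 2 * (X + (P.L : ℝ) ^ 2 / 4 * P.mesh 0 ^ 2 * B + (P.L : ℝ) ^ 2 / 4 * P.d * θ ^ 2 * S)
        = c₁ * (P.mesh 0)⁻¹ ^ 2 * X + c₁ * ((P.L : ℝ) ^ 2 / 4) * ((P.mesh 0)⁻¹ ^ 2 * P.mesh 0 ^ 2) * B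
          + c₁ * (P.mesh 0)⁻¹ ^ 2 * ((P.L : ℝ) ^ 2 / 4 * P.d * θ ^ 2 * S) := by ring
    rw [hmm, mul_one] at e
    linarith
  have F2 : c₁ * ((P.mesh 0)⁻¹ ^ 2 * X) ≤ a * ((P.L : ℝ) ^ 2)⁻¹ * ((P.mesh 0)⁻¹ ^ 2 * X) :=
    mul_le_mul_of_nonneg_right hc₁a (mul_nonneg hmi0.le hX0)
  have F3 : c₁ * ((P.L : ℝ) ^ 2 / 4) * B ≤ 1 * B := mul_le_mul_of_nonneg_right hc₁γ hB0
  have F5 : 0 ≤ msq * S := mul_nonneg hmsq hS0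
  have F6 : c₁ * (P.mesh 0)⁻¹ ^ 2 * ((P.L : ℝ) ^ 2 / 4 * P.d * θ ^ 2 * S) ≤ c₁ * (P.mesh 0)⁻¹ ^ 2 * (1 / 4 * S) := by
    have h2 : (P.L : ℝ) ^ 2 / 4 * P.d * θ ^ 2 ≤ 1 / 4 := by linarith
    exact mul_le_mul_of_nonneg_left (mul_le_mul_of_nonneg_right h2 hS0) (mul_nonneg hc₁0 hmi0.le)
  linarith

end LevelZero


/-! ## §7 (v1.2) The printed shape on the torus: (2.23)-regular `A`, «for e sufficiently small» -/

section PrintedTorus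

open B2Ineq329RegularField (gamma0_regular_spec)

/-- **(2.33) LOWER HALF ON THE TORUS IN THE PRINTED SHAPE, GENERAL REGULAR `A`** — *"there exist positive constants … γ₀ … dependent
on d and a, and independent of A, k, Ω and Λ"* ([B1] p. 611), *"for e sufficiently small"* ([B4] p. 593).  For `d`, `L`, `a, m² > 0` and a
regularity constant `c` there are `E₀ > 0` and `γ > 0` (functions of `d, L, a, m², c`) such that for every charge with `e² ≤ E₀`, every torus
of the family, every level `1 ≦ k = j+1 < K_P` with `L^kε ≦ 1` and at least two `(k+1)`-sites per direction, every `A` `δ`-regular on `T_ε`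
with `L^k·δ ≦ c·|e|` ((2.23) `|(∂^ηA)(x)| ≦ ce(L^kε)^{β−1}` in lattice units, `β ≧ 0`) and EVERY `ψ : T^{(k)} → ℝ^N`:
`γ(L^kε)^{−2}‖ψ‖² ≦ ⟨ψ, (a(L^{k+1}ε)^{−2}P(A) + Δ^{(k),L^kε}(T_ε, A))ψ⟩`; `γ = min{a, 4γ₀}/(2L²)` — `ineq233_lower_regular_torus` with its three
smallness conditions discharged from `e² ≤ E₀`. [cite: Balaban1982Higgs1, Prop. 2.3 (2.33) p.611, Prop. 2.1 (2.23) p.610]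
[cite: Balaban1983RegularityDecay, §5 (5.2)–(5.3) p.593, Prop. 3.1′ (1.21)–(1.22) p.574] -/
theorem ineq233_lower_printed_torus (d L : ℕ) (hL1 : 1 < L) {a msq : ℝ} (ha : 0 < a) (hmsq : 0 < msq) (c : ℝ) (N : ℕ) :
    ∃ E₀ : ℝ, 0 < E₀ ∧ ∃ γ : ℝ, 0 < γ ∧
      ∀ (C : ChargeData N), C.e ^ 2 ≤ E₀ →
      ∀ (P : HiggsLattice.Params), P.d = d → P.L = L →
      ∀ {j : ℕ}, j + 1 < P.K → (∀ μ, 2 ≤ P.sitesPerDir (j + 1 + 1) μ) → P.mesh (j + 1) ≤ 1 →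
      ∀ (A : HiggsLattice.VecField P 0) {δ : ℝ}, 0 ≤ δ →
        (∀ (z : HiggsLattice.Site P 0) (μ' ν : Fin P.d), |A ⟨z.shift ν, μ'⟩ - A ⟨z, μ'⟩| ≤ δ) →
        (P.L : ℝ) ^ (j + 1) * δ ≤ c * |C.e| →
        ∀ ψ : ScalarField P (j + 1) N,
          γ * ((P.mesh (j + 1))⁻¹ ^ 2) * siteInner ψ ψ ≤ siteInner ψ (precOpA C Finset.univ A msq a (j + 1) ψ) := by
  obtain ⟨γ₀, hγ₀⟩ : ∃ γ₀ : ℝ, γ₀ = min (a * (1 - ((L : ℝ) ^ 2)⁻¹) / (8 * (d : ℝ) + 2 * msq + 4)) (1 / 16) := ⟨_, rfl⟩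
  obtain ⟨c₁, hc₁⟩ : ∃ c₁ : ℝ, c₁ = min a (4 * γ₀) / (L : ℝ) ^ 2 := ⟨_, rfl⟩
  obtain ⟨E, hE⟩ : ∃ E : ℝ, E = min 1 (min (1 / (16 * ((d : ℝ) ^ 4 * (L : ℝ) ^ d * c ^ 2) + 1))
      (min (c₁ / (256 * (γ₀ * (d : ℝ) ^ 3 * c ^ 2) + 1)) (1 / (4 * ((d : ℝ) ^ 3 * (L : ℝ) ^ 4 * c ^ 2) + 1)))) := ⟨_, rfl⟩
  have hLr : (1 : ℝ) < (L : ℝ) := by exact_mod_cast hL1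
  have hγ₀pos : 0 < γ₀ := by
    rw [hγ₀]
    refine lt_min (div_pos (mul_pos ha ?_) (by positivity)) (by norm_num)
    have h1 : (1 : ℝ) < (L : ℝ) ^ 2 := by
      have h := mul_lt_mul hLr hLr.le zero_lt_one (zero_le_one.trans hLr.le)
      rw [one_mul] at h; rw [sq]; exact h
    have : ((L : ℝ) ^ 2)⁻¹ < 1 := inv_lt_one_of_one_lt₀ h1
    linarith
  have hc₁pos : 0 < c₁ := by rw [hc₁]; exact div_pos (lt_min ha (by linarith)) (by positivity)
  have hX0 : 0 ≤ (d : ℝ) ^ 4 * (L : ℝ) ^ d * c ^ 2 := by positivity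
  have hY0 : 0 ≤ γ₀ * (d : ℝ) ^ 3 * c ^ 2 := by positivity
  have hZ0 : 0 ≤ (d : ℝ) ^ 3 * (L : ℝ) ^ 4 * c ^ 2 := by positivity
  have hEpos : 0 < E := by
    rw [hE]
    exact lt_min one_pos (lt_min (by positivity) (lt_min (div_pos hc₁pos (by positivity)) (by positivity)))
  refine ⟨E, hEpos, c₁ / 2, by linarith, ?_⟩
  intro C heE P hPd hPL j hjK hN2 hs A δ hδ hreg hu ψ
  subst hPd hPL
  have hLnat : 1 < P.L := hL1
  have hmesh : 0 < P.mesh (j + 1) := P.mesh_pos _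
  have hmeshK : P.mesh (j + 1) = (P.L : ℝ) ^ (j + 1) * P.mesh 0 := by
    unfold HiggsLattice.Params.mesh; ring
  have hE1 : E ≤ 1 := by rw [hE]; exact min_le_left _ _
  have he2 : C.e ^ 2 ≤ 1 := heE.trans hE1
  have hu0 : 0 ≤ (P.L : ℝ) ^ (j + 1) * δ := by positivity
  -- the basic square: `(Lᵏδ)²·e² ≤ c²·E`
  have hsq : ((P.L : ℝ) ^ (j + 1) * δ) ^ 2 * C.e ^ 2 ≤ c ^ 2 * E := by
    have h1 : ((P.L : ℝ) ^ (j + 1) * δ) ^ 2 ≤ c ^ 2 * C.e ^ 2 :=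
      calc ((P.L : ℝ) ^ (j + 1) * δ) ^ 2 ≤ (c * |C.e|) ^ 2 := pow_le_pow_left₀ hu0 hu 2
        _ = c ^ 2 * C.e ^ 2 := by rw [mul_pow, sq_abs]
    have h2 : C.e ^ 2 * C.e ^ 2 ≤ E :=
      calc C.e ^ 2 * C.e ^ 2 ≤ E * 1 := mul_le_mul heE he2 (sq_nonneg _) hEpos.le
        _ = E := mul_one E
    calc ((P.L : ℝ) ^ (j + 1) * δ) ^ 2 * C.e ^ 2 ≤ c ^ 2 * C.e ^ 2 * C.e ^ 2 :=
          mul_le_mul_of_nonneg_right h1 (sq_nonneg _)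
      _ = c ^ 2 * (C.e ^ 2 * C.e ^ 2) := by ring
      _ ≤ c ^ 2 * E := mul_le_mul_of_nonneg_left h2 (sq_nonneg c)
  -- the constant `γ₀` of (II.3.29) at a regular field
  obtain ⟨-, hγB, hγ16⟩ := gamma0_regular_spec (P := P) ha hLnat hmsq.le
  rw [← hγ₀] at hγB hγ16
  -- (i) `hsmall`
  have hsmall : 8 * (P.d : ℝ) ^ 4 * (P.L : ℝ) ^ P.d * C.e ^ 2 * P.mesh (j + 1) ^ 2 *
      ((P.L : ℝ) ^ (j + 1)) ^ 2 * δ ^ 2 ≤ 1 / 2 := by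
    have hEX : E ≤ 1 / (16 * ((P.d : ℝ) ^ 4 * (P.L : ℝ) ^ P.d * c ^ 2) + 1) := by
      rw [hE]; exact (min_le_right _ _).trans (min_le_left _ _)
    rw [le_div_iff₀ (by positivity)] at hEX
    have hs2 : P.mesh (j + 1) ^ 2 ≤ 1 := pow_le_one₀ hmesh.le hs
    calc 8 * (P.d : ℝ) ^ 4 * (P.L : ℝ) ^ P.d * C.e ^ 2 * P.mesh (j + 1) ^ 2 * ((P.L : ℝ) ^ (j + 1)) ^ 2 * δ ^ 2
        = 8 * ((P.d : ℝ) ^ 4 * (P.L : ℝ) ^ P.d) * (((P.L : ℝ) ^ (j + 1) * δ) ^ 2 * C.e ^ 2) * P.mesh (j + 1) ^ 2 := by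
          ring
      _ ≤ 8 * ((P.d : ℝ) ^ 4 * (P.L : ℝ) ^ P.d) * (c ^ 2 * E) * 1 := by
          refine mul_le_mul (mul_le_mul_of_nonneg_left hsq (by positivity)) hs2 (sq_nonneg _) (by positivity)
      _ = 8 * (((P.d : ℝ) ^ 4 * (P.L : ℝ) ^ P.d * c ^ 2) * E) := by ring
      _ ≤ 1 / 2 := by linarith [mul_nonneg hX0 hEpos.le]
  -- (ii) `hE`
  have hEE : 64 * γ₀ * (P.d : ℝ) ^ 3 * C.e ^ 2 * ((P.L : ℝ) ^ (j + 1)) ^ 2 * δ ^ 2 * P.mesh (j + 1) ^ 2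
      ≤ min a (4 * γ₀) / (P.L : ℝ) ^ 2 / 4 := by
    have hEY : E ≤ c₁ / (256 * (γ₀ * (P.d : ℝ) ^ 3 * c ^ 2) + 1) := by
      rw [hE]; exact (min_le_right _ _).trans ((min_le_right _ _).trans (min_le_left _ _))
    rw [le_div_iff₀ (by positivity)] at hEY
    have hs2 : P.mesh (j + 1) ^ 2 ≤ 1 := pow_le_one₀ hmesh.le hs
    rw [← hc₁]
    calc 64 * γ₀ * (P.d : ℝ) ^ 3 * C.e ^ 2 * ((P.L : ℝ) ^ (j + 1)) ^ 2 * δ ^ 2 * P.mesh (j + 1) ^ 2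
        = 64 * (γ₀ * (P.d : ℝ) ^ 3) * (((P.L : ℝ) ^ (j + 1) * δ) ^ 2 * C.e ^ 2) * P.mesh (j + 1) ^ 2 := by ring
      _ ≤ 64 * (γ₀ * (P.d : ℝ) ^ 3) * (c ^ 2 * E) * 1 := by
          refine mul_le_mul (mul_le_mul_of_nonneg_left hsq (by positivity)) hs2 (sq_nonneg _) (by positivity)
      _ = 64 * ((γ₀ * (P.d : ℝ) ^ 3 * c ^ 2) * E) := by ring
      _ ≤ c₁ / 4 := by linarith [mul_nonneg hY0 hEpos.le]
  -- (iii) `hθ`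
  have hθ : (P.L : ℝ) ^ 2 * P.d *
      (2 * P.d * P.L * ((P.L : ℝ) ^ (j + 1)) ^ 2 * (P.mesh 0 * |C.e|) * δ) ^ 2 ≤ 1 := by
    have hEZ : E ≤ 1 / (4 * ((P.d : ℝ) ^ 3 * (P.L : ℝ) ^ 4 * c ^ 2) + 1) := by
      rw [hE]; exact (min_le_right _ _).trans ((min_le_right _ _).trans (min_le_right _ _))
    rw [le_div_iff₀ (by positivity)] at hEZ
    have hs2 : P.mesh (j + 1) ^ 2 ≤ 1 := pow_le_one₀ hmesh.le hs
    have e1 : ((P.L : ℝ) ^ (j + 1)) ^ 2 * P.mesh 0 * δ = ((P.L : ℝ) ^ (j + 1) * δ) * P.mesh (j + 1) := by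
      rw [hmeshK]; ring
    calc (P.L : ℝ) ^ 2 * P.d * (2 * P.d * P.L * ((P.L : ℝ) ^ (j + 1)) ^ 2 * (P.mesh 0 * |C.e|) * δ) ^ 2
        = 4 * ((P.d : ℝ) ^ 3 * (P.L : ℝ) ^ 4) * ((((P.L : ℝ) ^ (j + 1)) ^ 2 * P.mesh 0 * δ) ^ 2 * |C.e| ^ 2) := by ring
      _ = 4 * ((P.d : ℝ) ^ 3 * (P.L : ℝ) ^ 4) * ((((P.L : ℝ) ^ (j + 1) * δ) ^ 2 * C.e ^ 2) * P.mesh (j + 1) ^ 2) := by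
          rw [e1, sq_abs]; ring
      _ ≤ 4 * ((P.d : ℝ) ^ 3 * (P.L : ℝ) ^ 4) * ((c ^ 2 * E) * 1) := by
          refine mul_le_mul_of_nonneg_left ?_ (by positivity)
          exact mul_le_mul hsq hs2 (sq_nonneg _) (by positivity)
      _ = 4 * (((P.d : ℝ) ^ 3 * (P.L : ℝ) ^ 4 * c ^ 2) * E) := by ring
      _ ≤ 1 := by linarith [mul_nonneg hZ0 hEpos.le]
  have hmain := ineq233_lower_regular_torus C ha hLnat hmsq hjK hN2 hs A hδ hreg hsmall hγ₀pos.le hγB hγ16 hEE hθ ψ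
  rw [← hc₁] at hmain
  exact hmain

end PrintedTorus

end Literature.MathematicalPhysics.QuantumFieldTheory.Balaban1983to89.B1Ineq233LowerBackgroundTorus

end
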